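import Literature.Combinatorics.SimpleGraph.CopyContainers
import Literature.Probability.RandomGraphs.ErdosRenyiCylinder
import Literature.Probability.RandomGraphs.RandomRamsey
import Mathlib.Analysis.SpecialFunctions.Stirling
import Mathlib.Analysis.SpecialFunctions.Pow.Asymptotics
import Mathlib.Analysis.SpecialFunctions.Sqrt
import Mathlib.Topology.Instances.ENNReal.Lemmas
import HarnessLib

/-!
# The Rödl–Ruciński 1-statement, proved (`RodlRucinski1995_oneStatement_holds`)

Discharge of the named fact `Literature.Probability.RandomGraphs.RodlRucinski1995_oneStatement`
(Rödl–Ruciński, JAMS 1995, Thm. 1′, 1-statement: for every graph `F` containing a cycle —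
`m₂(F) > 1` — and every `r ≥ 2` there is `C > 0` with `Pr[G(n, p(n)) → (F)_r] → 1` whenever
`p(n) ≥ C n^{-1/m₂(F)}` for all large `n`), by Nenadov–Steger's short proof (CPC 2016, §2,
proof of Thm. 1, 1-statement, p. 3), on top of the container theorem
(`Literature/Combinatorics/Hypergraph/Containers.lean`, Bernshteyn–Delcourt–Towsner–Tserunyan's
proof), its iteration and the sparsification (`ContainersIterated.lean`), the copy hypergraph
(`CopyHypergraph.lean`), Ramsey supersaturation (`RamseySupersaturation.lean`: NS Thm. 2,
Cor. 3), the containers for `F`-free graphs (`CopyContainers.lean`: NS Thm. 5) and the cylinder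
probabilities of `G(n,p)` (`ErdosRenyiCylinder.lean`).

## Contents, following Nenadov–Steger p. 3 literally

* `exists_validPrints_of_not_arrows` — "If `G_{n,p} ↛ (F)^e_r` then there exists a colouring …
  `E_j` does not contain a copy of `F` … `T_{i_j} ⊆ E_j ⊆ C_{i_j}` … `G_{n,p}` completely avoids
  `E(K_n) ∖ (C_{i_1} ∪ … ∪ C_{i_r})`": a non-arrowing graph contains all fingerprints of a VALID
  tuple of fingerprint arrays (one per colour class) and avoids the pairs outside their containers.
* `sum_pow_card_unionPrints_le` — the count "first deciding on `s := |⋃ T|`, then choosing that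
  many edges, and finally deciding for every edge in which sets of the tuples it appears":
  `∑_P y^{|⋃P|} ≤ ∑_{s ≤ S} C(C(n,2), s) (2^{rRT} y)^s`.
* `not_arrows_prob_le` — the union bound with the cylinder probabilities
  (`erdosRenyi_toOuterMeasure_cylinder_ofReal`): given the container data (output of
  `ns_theorem5`) and the supersaturation corollary (output of `ns_corollary3`),
  `Pr[G(n,p) ↛ (F)_r] ≤ (1-p)^{⌈δn²⌉} ∑_{s ≤ ⌊rRTΦ⌋} C(C(n,2),s) (2^{rRT}p)^s`.
* `unionBound_real_le` — the calculus ("By choosing `C` sufficiently large …"): with `N = C(n,2)`,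
  `D = n^{1/m₂}`, `u = pD ≥ max(Q/2^Q, 4Q/δ, 16Q²(2^Q/Q)/δ²)` the right-hand side is
  `≤ exp(-(δ/2) u n²/D)`, via the truncated binomial sum (`sum_choose_mul_pow_le`), Stirling
  (`pow_div_factorial_le_stirling`), monotonicity of `s(1 + log(X/s))`, and `log x ≤ 2√x`.
* `eventually_largeness` — the explicit largeness conditions of `ns_theorem5` hold for large `n`.
* `not_arrows_le_exp_at`, `oneStatement_core` — for `F` without isolated vertices (`k ≥ 3`,
  `m₂(F) > 1`, `r ≥ 1`): the constants (supersaturation `M, ε, δ`; container `η, γ, R`; `C`) and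
  `Pr[G(n,p_n) ↛ (F)_r] ≤ exp(-(δC/2) n^{2-1/m₂(F)}) → 0`, hence `Pr[→] → 1` by the complement
  rule (`tendsto_arrows_of_compl_le`).
* `RodlRucinski1995_oneStatement_holds` — general `F`: remove isolated vertices (`fplus`;
  `m₂(F⁺) ≤ m₂(F)`, `m₂(F⁺) > 1`, `k⁺ ≥ 3`; `G → (F⁺)_r ⟹ G → (F)_r` on `≥ k` vertices by
  extending the embedding, `exists_extend_embedding`), and clamp `p` to `[0, 1]`
  (`erdosRenyi_min_one`).

No named facts are introduced (small definitions: `unionPrints`, `outsidePairs`, `ValidPrints`,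
`vplus`, `vemb`, `fplus`); this file discharges one.

## References

* V. Rödl, A. Ruciński, *Threshold functions for Ramsey properties*, JAMS 8 (1995), Thm. 1′
  (p. 919). [RodlRucinski1995]
* R. Nenadov, A. Steger, *A short proof of the random Ramsey theorem*, CPC 25 (2016), Thm. 1
  and §2 (pp. 1–3). [NenadovSteger2014]
-/

/-! ## The union bound of Nenadov–Steger's proof of the 1-statement (fixed `n`) -/

namespace Literature.Probability.RandomGraphs

open Finset Literature.Combinatorics.Hypergraph Literature.Combinatorics.SimpleGraph
open _root_.SimpleGraph

section UnionBound

variable {n k r R T : ℕ} {F : _root_.SimpleGraph (Fin k)}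

/-- The union of all fingerprints of an `r`-tuple of fingerprint arrays. [folklore] -/
def unionPrints (P : Fin r → Fin R → Fin T → Finset (Sym2 (Fin n))) : Finset (Sym2 (Fin n)) :=
  univ.biUnion fun t : Fin r × Fin R × Fin T => P t.1 t.2.1 t.2.2

/-- Membership in `unionPrints`. [folklore] -/
theorem mem_unionPrints {P : Fin r → Fin R → Fin T → Finset (Sym2 (Fin n))} {x : Sym2 (Fin n)} :
    x ∈ unionPrints P ↔ ∃ j ρ i, x ∈ P j ρ i := by
  simp only [unionPrints, mem_biUnion, mem_univ, true_and, Prod.exists]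

/-- The pairs of `K_n` outside all containers of an `r`-tuple of fingerprint arrays
(Nenadov–Steger's `E₀(T_{i_1}, …, T_{i_r}) = E(K_n) ∖ (C_{i_1} ∪ … ∪ C_{i_r})`).
[cite: NenadovSteger2014, proof of Thm. 1 (1-statement), p. 3] -/
def outsidePairs (Cont : (Fin R → Fin T → Finset (Sym2 (Fin n))) → Finset (Sym2 (Fin n)))
    (P : Fin r → Fin R → Fin T → Finset (Sym2 (Fin n))) : Finset (Sym2 (Fin n)) :=
  pairsX n \ univ.biUnion fun j => Cont (P j)

/-- An `r`-tuple of fingerprint arrays is VALID if it arises from an `r`-tuple of `F`-free edge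
sets. [folklore] -/
def ValidPrints (F : _root_.SimpleGraph (Fin k)) [DecidableRel F.Adj]
    (Print : Finset (Sym2 (Fin n)) → (Fin R → Fin T → Finset (Sym2 (Fin n))))
    (P : Fin r → Fin R → Fin T → Finset (Sym2 (Fin n))) : Prop :=
  ∃ E : Fin r → Finset (Sym2 (Fin n)),
    ∀ j, E j ⊆ pairsX n ∧ IsIndep (copyH F n) (E j) ∧ P j = Print (E j)

variable [DecidableRel F.Adj]

/-- **An edge set containing a copy contains `F`**: if some hyperedge of the copy hypergraph lies
in `E(G)` then `F ⊑ G` (the embedding is an injective homomorphism). [folklore] -/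
theorem isContained_of_not_isIndep (G : _root_.SimpleGraph (Fin n)) [DecidableRel G.Adj]
    (h : ¬ IsIndep (copyH F n) G.edgeFinset) : F ⊑ G := by
  unfold IsIndep at h
  push Not at h
  obtain ⟨e, he, heG⟩ := h
  obtain ⟨φ, rfl⟩ := mem_copyH.1 he
  refine ⟨⟨⟨φ, fun {a b} hab => ?_⟩, φ.injective⟩⟩
  have : φ.sym2Map s(a, b) ∈ G.edgeFinset :=
    heG (mem_copyMap.2 ⟨s(a, b), by rwa [mem_edgeFinset], rfl⟩)
  rw [Function.Embedding.sym2Map_apply, Sym2.map_mk, mem_edgeFinset] at this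
  exact this

/-- **The covering step** (Nenadov–Steger p. 3: "If `G_{n,p} ↛ (F)^e_r`, then there exists a
colouring … such that `E_j` does not contain a copy of `F`. … `T_{i_j} ⊆ E_j ⊆ C_{i_j}` … `G_{n,p}`
completely avoids `E(K_n) ∖ (C_{i_1} ∪ … ∪ C_{i_r})`"): a non-arrowing graph contains all
fingerprints of some valid tuple and avoids the pairs outside its containers.
[cite: NenadovSteger2014, proof of Thm. 1 (1-statement), p. 3] -/
theorem exists_validPrints_of_not_arrows
    (Print : Finset (Sym2 (Fin n)) → (Fin R → Fin T → Finset (Sym2 (Fin n))))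
    (Cont : (Fin R → Fin T → Finset (Sym2 (Fin n))) → Finset (Sym2 (Fin n)))
    (hPC : ∀ I ⊆ pairsX n, IsIndep (copyH F n) I →
      (∀ ρ i, Print I ρ i ⊆ I) ∧ I ⊆ Cont (Print I))
    (G : _root_.SimpleGraph (Fin n)) (hG : ¬ Arrows G F r) :
    ∃ P : Fin r → Fin R → Fin T → Finset (Sym2 (Fin n)), ValidPrints F Print P ∧
      (∀ x ∈ unionPrints P, x ∈ G.edgeSet) ∧ ∀ x ∈ outsidePairs Cont P, x ∉ G.edgeSet := by
  classical
  unfold Arrows at hG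
  obtain ⟨Cl, hCl⟩ := not_forall.1 hG
  rw [not_exists] at hCl
  -- colour classes
  set E : Fin r → Finset (Sym2 (Fin n)) := fun j => (Cl.labelGraph j).edgeFinset with hE
  have hEX : ∀ j, E j ⊆ pairsX n := by
    intro j x hx
    have hx' : x ∈ (Cl.labelGraph j).edgeSet := by rw [hE, mem_edgeFinset] at hx; exact hx
    exact mem_pairsX.2 (not_isDiag_of_mem_edgeSet _ hx')
  have hEind : ∀ j, IsIndep (copyH F n) (E j) := by
    intro j
    by_contra hind
    exact hCl j (isContained_of_not_isIndep (Cl.labelGraph j) hind)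
  refine ⟨fun j => Print (E j), ⟨E, fun j => ⟨hEX j, hEind j, rfl⟩⟩, ?_, ?_⟩
  · intro x hx
    rw [mem_unionPrints] at hx
    obtain ⟨j, ρ, i, hx⟩ := hx
    have hxE : x ∈ E j := (hPC (E j) (hEX j) (hEind j)).1 ρ i hx
    have : x ∈ (Cl.labelGraph j).edgeSet := by rw [hE, mem_edgeFinset] at hxE; exact hxE
    exact edgeSet_mono (EdgeLabeling.labelGraph_le Cl) this
  · intro x hx hxG
    rw [outsidePairs, mem_sdiff] at hx
    apply hx.2
    rw [mem_biUnion]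
    -- the colour of the edge `x`
    induction x using Sym2.ind with
    | _ a b =>
      have hadj : G.Adj a b := hxG
      set j := Cl ⟨s(a, b), hadj⟩ with hj
      refine ⟨j, mem_univ _, ?_⟩
      have hxE : s(a, b) ∈ E j := by
        rw [hE, mem_edgeFinset, mem_edgeSet, EdgeLabeling.labelGraph_adj]
        exact ⟨hadj, rfl⟩
      exact (hPC (E j) (hEX j) (hEind j)).2 hxE

/-- Fingerprints of a valid tuple lie inside the containers, hence are disjoint from the outside
pairs, and consist of pairs of distinct vertices. [folklore] -/
theorem unionPrints_props
    (Print : Finset (Sym2 (Fin n)) → (Fin R → Fin T → Finset (Sym2 (Fin n))))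
    (Cont : (Fin R → Fin T → Finset (Sym2 (Fin n))) → Finset (Sym2 (Fin n)))
    (hPC : ∀ I ⊆ pairsX n, IsIndep (copyH F n) I →
      (∀ ρ i, Print I ρ i ⊆ I) ∧ I ⊆ Cont (Print I))
    {P : Fin r → Fin R → Fin T → Finset (Sym2 (Fin n))} (hP : ValidPrints F Print P) :
    unionPrints P ⊆ pairsX n ∧ Disjoint (unionPrints P) (outsidePairs Cont P) := by
  obtain ⟨E, hEP⟩ := hP
  have hsub : ∀ j ρ i, P j ρ i ⊆ E j := by
    intro j ρ i
    rw [(hEP j).2.2]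
    exact (hPC (E j) (hEP j).1 (hEP j).2.1).1 ρ i
  constructor
  · intro x hx
    rw [mem_unionPrints] at hx
    obtain ⟨j, ρ, i, hx⟩ := hx
    exact (hEP j).1 (hsub j ρ i hx)
  · rw [Finset.disjoint_left]
    intro x hx hxD
    rw [mem_unionPrints] at hx
    obtain ⟨j, ρ, i, hx⟩ := hx
    rw [outsidePairs, mem_sdiff] at hxD
    apply hxD.2
    rw [mem_biUnion]
    refine ⟨j, mem_univ _, ?_⟩
    have := (hPC (E j) (hEP j).1 (hEP j).2.1).2 (hsub j ρ i hx)
    rwa [← (hEP j).2.2] at this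

/-- **Counting tuples by the union of their fingerprints** (Nenadov–Steger p. 3: "first deciding
on `s := |⋃ T|`, then choosing that many edges (`C(C(n,2), s)` choices) and finally deciding for
every edge in which sets of the `k`-tuples it appears (`(2^{rk})^s` choices)"): for `y ≥ 0` and any
family `Ps` of tuples whose fingerprint unions are subsets of `pairsX n` of size `≤ S`,
`∑_{P ∈ Ps} y^{|⋃ P|} ≤ ∑_{s ≤ S} C(C(n,2), s) (2^{r R T} y)^s`.
[cite: NenadovSteger2014, proof of Thm. 1 (1-statement), p. 3] -/
theorem sum_pow_card_unionPrints_le (Ps : Finset (Fin r → Fin R → Fin T → Finset (Sym2 (Fin n))))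
    (S : ℕ) (hPs : ∀ P ∈ Ps, unionPrints P ⊆ pairsX n ∧ #(unionPrints P) ≤ S) {y : ℝ} (hy : 0 ≤ y) :
    ∑ P ∈ Ps, y ^ #(unionPrints P) ≤
      ∑ s ∈ Finset.range (S + 1), ((n.choose 2).choose s : ℝ) * ((2 : ℝ) ^ (r * R * T) * y) ^ s := by
  classical
  set ι := Fin r × Fin R × Fin T
  have hι : Fintype.card (Finset ι) = 2 ^ (r * R * T) := by
    rw [Fintype.card_finset, Fintype.card_prod, Fintype.card_prod, Fintype.card_fin,
      Fintype.card_fin, Fintype.card_fin, mul_assoc]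
  -- group by the union
  rw [sum_comp (fun U : Finset (Sym2 (Fin n)) => y ^ #U) unionPrints]
  -- fibre bound: tuples with union inside `U'` inject into functions `U' → Finset ι`
  have hfib : ∀ U' : Finset (Sym2 (Fin n)),
      (#(Ps.filter fun P => unionPrints P = U') : ℝ) ≤ ((2 : ℝ) ^ (r * R * T)) ^ #U' := by
    intro U'
    have hcard : Fintype.card (U' → Finset ι) = (2 ^ (r * R * T)) ^ #U' := by
      rw [Fintype.card_fun, hι, Fintype.card_coe]
    have h1 : #(Ps.filter fun P => unionPrints P = U') ≤ #(univ : Finset (U' → Finset ι)) := by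
      refine card_le_card_of_injOn
        (fun P => fun x : U' => univ.filter fun t : ι => (x : Sym2 (Fin n)) ∈ P t.1 t.2.1 t.2.2)
        (fun P _ => mem_coe.2 (mem_univ _)) ?_
      intro P₁ hP₁ P₂ hP₂ h
      simp only [coe_filter, Set.mem_setOf_eq] at hP₁ hP₂
      funext j ρ i
      ext x
      by_cases hxU : x ∈ U'
      · have := congrFun h ⟨x, hxU⟩
        simp only at this
        have h' := Finset.ext_iff.1 this (j, ρ, i)
        simp only [mem_filter, mem_univ, true_and] at h'
        exact h'
      · constructor
        · intro hx
          exact absurd (hP₁.2 ▸ mem_unionPrints.2 ⟨j, ρ, i, hx⟩) hxU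
        · intro hx
          exact absurd (hP₂.2 ▸ mem_unionPrints.2 ⟨j, ρ, i, hx⟩) hxU
    rw [card_univ, hcard] at h1
    exact_mod_cast h1
  calc ∑ U' ∈ Ps.image unionPrints, #(Ps.filter fun P => unionPrints P = U') • y ^ #U'
      ≤ ∑ U' ∈ Ps.image unionPrints, ((2 : ℝ) ^ (r * R * T)) ^ #U' * y ^ #U' := by
        refine sum_le_sum fun U' _ => ?_
        rw [nsmul_eq_mul]
        exact mul_le_mul_of_nonneg_right (hfib U') (by positivity)
    _ ≤ ∑ U' ∈ (pairsX n).powerset.filter (fun U => #U ≤ S),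
          ((2 : ℝ) ^ (r * R * T)) ^ #U' * y ^ #U' := by
        refine sum_le_sum_of_subset_of_nonneg (fun U' hU' => ?_) fun _ _ _ => by positivity
        rw [mem_image] at hU'
        obtain ⟨P, hP, rfl⟩ := hU'
        rw [mem_filter, mem_powerset]
        exact hPs P hP
    _ = ∑ s ∈ Finset.range (S + 1), ∑ U' ∈ (pairsX n).powersetCard s,
          ((2 : ℝ) ^ (r * R * T)) ^ #U' * y ^ #U' := by
        rw [← sum_biUnion]
        · congr 1
          ext U'
          simp only [mem_filter, mem_powerset, mem_biUnion, Finset.mem_range, mem_powersetCard]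
          constructor
          · rintro ⟨h1, h2⟩; exact ⟨#U', by omega, h1, rfl⟩
          · rintro ⟨s, hs, h1, h2⟩; exact ⟨h1, by omega⟩
        · intro s₁ _ s₂ _ hne
          exact (pairsX n).pairwise_disjoint_powersetCard hne
    _ = ∑ s ∈ Finset.range (S + 1), ((n.choose 2).choose s : ℝ) * ((2 : ℝ) ^ (r * R * T) * y) ^ s := by
        refine sum_congr rfl fun s _ => ?_
        rw [sum_congr rfl fun U' hU' => by rw [(mem_powersetCard.1 hU').2], sum_const,
          card_powersetCard, card_pairsX, nsmul_eq_mul, mul_pow]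

end UnionBound

end Literature.Probability.RandomGraphs

namespace Literature.Probability.RandomGraphs

open Finset Literature.Combinatorics.Hypergraph Literature.Combinatorics.SimpleGraph
open _root_.SimpleGraph _root_.MeasureTheory

section ProbBound

variable {n k r R T : ℕ} {F : _root_.SimpleGraph (Fin k)} [DecidableRel F.Adj]

/-- **Nenadov–Steger's union bound at a fixed `n`** (CPC 2016, p. 3):
`P[G_{n,p} ↛ (F)^e_r] ≤ ∑_{i_1,…,i_r} P[T_{i_1},…,T_{i_r} ⊆ G_{n,p} ∧ G_{n,p} ∩ E₀ = ∅]`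
`≤ (1-p)^{δn²} ∑_{s ≤ S} C(C(n,2), s) (2^{rk})^s p^s`. Here the container data
(`Print`, `Cont`, their properties — the output of `ns_theorem5`) and the supersaturation
corollary (`hcor` — the output of `ns_corollary3`) are hypotheses, `R × T` is the shape of one
fingerprint array, fingerprints have size `≤ Φ`, and `S = ⌊r R T Φ⌋`.
[cite: NenadovSteger2014, proof of Thm. 1 (1-statement), p. 3] -/
theorem not_arrows_prob_le
    (Print : Finset (Sym2 (Fin n)) → (Fin R → Fin T → Finset (Sym2 (Fin n))))
    (Cont : (Fin R → Fin T → Finset (Sym2 (Fin n))) → Finset (Sym2 (Fin n))) {Φ ε δ : ℝ}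
    (hPC : ∀ I ⊆ pairsX n, IsIndep (copyH F n) I →
      (∀ ρ i, Print I ρ i ⊆ I ∧ (#(Print I ρ i) : ℝ) ≤ Φ) ∧
      Cont (Print I) ⊆ pairsX n ∧ I ⊆ Cont (Print I) ∧
      (#(induce (copyH F n) (Cont (Print I))) : ℝ) < ε * #(copyH F n))
    (hcor : ∀ Cs : Fin r → Finset (Sym2 (Fin n)), (∀ j, Cs j ⊆ pairsX n) →
      (∀ j, (#(induce (copyH F n) (Cs j)) : ℝ) < ε * #(copyH F n)) →
      δ * (n : ℝ) ^ 2 ≤ #(pairsX n \ Finset.univ.biUnion Cs))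
    {p : ℝ} (hp0 : 0 ≤ p) (hp1 : p ≤ 1) :
    (erdosRenyi n p).toOuterMeasure {G | ¬ Arrows G F r} ≤
      ENNReal.ofReal ((1 - p) ^ ⌈δ * (n : ℝ) ^ 2⌉₊ *
        ∑ s ∈ Finset.range (⌊(r * R * T : ℝ) * Φ⌋₊ + 1),
          ((n.choose 2).choose s : ℝ) * ((2 : ℝ) ^ (r * R * T) * p) ^ s) := by
  classical
  set Ps : Finset (Fin r → Fin R → Fin T → Finset (Sym2 (Fin n))) :=
    univ.filter fun P => ValidPrints F Print P with hPs
  have hPC' : ∀ I ⊆ pairsX n, IsIndep (copyH F n) I →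
      (∀ ρ i, Print I ρ i ⊆ I) ∧ I ⊆ Cont (Print I) :=
    fun I hI hind => ⟨fun ρ i => ((hPC I hI hind).1 ρ i).1, (hPC I hI hind).2.2.1⟩
  -- the events
  set A : (Fin r → Fin R → Fin T → Finset (Sym2 (Fin n))) → Set (_root_.SimpleGraph (Fin n)) :=
    fun P => {G | (∀ x ∈ unionPrints P, x ∈ G.edgeSet) ∧ ∀ x ∈ outsidePairs Cont P, x ∉ G.edgeSet}
    with hA
  have hcover : {G : _root_.SimpleGraph (Fin n) | ¬ Arrows G F r} ⊆ ⋃ P ∈ Ps, A P := by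
    intro G hG
    obtain ⟨P, hPv, hU, hD⟩ := exists_validPrints_of_not_arrows Print Cont hPC' G hG
    rw [Set.mem_iUnion₂]
    exact ⟨P, by rw [hPs]; exact mem_filter.2 ⟨mem_univ _, hPv⟩, hU, hD⟩
  -- facts about valid tuples
  have hvalid : ∀ P ∈ Ps, unionPrints P ⊆ pairsX n ∧
      Disjoint (unionPrints P) (outsidePairs Cont P) ∧
      #(unionPrints P) ≤ ⌊(r * R * T : ℝ) * Φ⌋₊ ∧
      δ * (n : ℝ) ^ 2 ≤ #(outsidePairs Cont P) := by
    intro P hP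
    rw [hPs, mem_filter] at hP
    obtain ⟨hUX, hdisj⟩ := unionPrints_props Print Cont hPC' hP.2
    obtain ⟨E, hEP⟩ := hP.2
    refine ⟨hUX, hdisj, ?_, ?_⟩
    · apply Nat.le_floor
      calc (#(unionPrints P) : ℝ) ≤ ∑ t : Fin r × Fin R × Fin T, (#(P t.1 t.2.1 t.2.2) : ℝ) := by
            rw [unionPrints]; exact_mod_cast card_biUnion_le
        _ ≤ ∑ _t : Fin r × Fin R × Fin T, Φ := by
            refine sum_le_sum fun t _ => ?_
            rw [(hEP t.1).2.2]
            exact ((hPC (E t.1) (hEP t.1).1 (hEP t.1).2.1).1 t.2.1 t.2.2).2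
        _ = (r * R * T : ℝ) * Φ := by
            rw [sum_const, card_univ, Fintype.card_prod, Fintype.card_prod, Fintype.card_fin,
              Fintype.card_fin, Fintype.card_fin, nsmul_eq_mul]
            push_cast; ring
    · have := hcor (fun j => Cont (P j)) (fun j => by
        rw [(hEP j).2.2]; exact (hPC (E j) (hEP j).1 (hEP j).2.1).2.1) (fun j => by
        rw [(hEP j).2.2]; exact (hPC (E j) (hEP j).1 (hEP j).2.1).2.2.2)
      exact this
  -- the bound
  calc (erdosRenyi n p).toOuterMeasure {G | ¬ Arrows G F r}
      ≤ (erdosRenyi n p).toOuterMeasure (⋃ P ∈ Ps, A P) := measure_mono hcover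
    _ ≤ ∑ P ∈ Ps, (erdosRenyi n p).toOuterMeasure (A P) := measure_biUnion_finset_le Ps A
    _ = ∑ P ∈ Ps, ENNReal.ofReal (p ^ #(unionPrints P) * (1 - p) ^ #(outsidePairs Cont P)) := by
        refine sum_congr rfl fun P hP => ?_
        obtain ⟨hUX, hdisj, -, -⟩ := hvalid P hP
        rw [hA]
        exact erdosRenyi_toOuterMeasure_cylinder_ofReal hp0 hp1 _ _ hdisj
          (fun x hx => mem_pairsX.1 (hUX hx))
          (fun x hx => mem_pairsX.1 (sdiff_subset (s := pairsX n) (t := univ.biUnion fun j => Cont (P j)) hx))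
    _ ≤ ∑ P ∈ Ps, ENNReal.ofReal (p ^ #(unionPrints P) * (1 - p) ^ ⌈δ * (n : ℝ) ^ 2⌉₊) := by
        refine sum_le_sum fun P hP => ENNReal.ofReal_le_ofReal ?_
        obtain ⟨-, -, -, hDδ⟩ := hvalid P hP
        apply mul_le_mul_of_nonneg_left _ (by positivity)
        apply pow_le_pow_of_le_one (by linarith) (by linarith)
        exact Nat.ceil_le.2 hDδ
    _ = ENNReal.ofReal (∑ P ∈ Ps, p ^ #(unionPrints P) * (1 - p) ^ ⌈δ * (n : ℝ) ^ 2⌉₊) := by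
        rw [ENNReal.ofReal_sum_of_nonneg]
        intro P _
        have : 0 ≤ 1 - p := by linarith
        positivity
    _ = ENNReal.ofReal ((1 - p) ^ ⌈δ * (n : ℝ) ^ 2⌉₊ * ∑ P ∈ Ps, p ^ #(unionPrints P)) := by
        rw [mul_sum]
        congr 1
        exact sum_congr rfl fun P _ => mul_comm _ _
    _ ≤ _ := by
        apply ENNReal.ofReal_le_ofReal
        have : 0 ≤ 1 - p := by linarith
        apply mul_le_mul_of_nonneg_left _ (by positivity)
        exact sum_pow_card_unionPrints_le Ps _ (fun P hP => ⟨(hvalid P hP).1, (hvalid P hP).2.2.1⟩) hp0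

end ProbBound

end Literature.Probability.RandomGraphs

namespace Literature.Probability.RandomGraphs

open Finset Real

section Analysis

/-- Terms `(Ny)^s/s!` increase in `s` as long as `s ≤ Ny`. [folklore] -/
theorem pow_div_factorial_mono {x : ℝ} (hx : 0 ≤ x) {S : ℕ} (hS : (S : ℝ) ≤ x) :
    ∀ s ≤ S, x ^ s / s.factorial ≤ x ^ S / S.factorial := by
  -- one step
  have hstep : ∀ s, s + 1 ≤ S → x ^ s / s.factorial ≤ x ^ (s + 1) / (s + 1).factorial := by
    intro s hs
    have hs1 : (s : ℝ) + 1 ≤ x := le_trans (by exact_mod_cast hs) hS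
    have hfac : (0 : ℝ) < s.factorial := by exact_mod_cast Nat.factorial_pos s
    rw [Nat.factorial_succ, Nat.cast_mul, pow_succ, div_le_div_iff₀ hfac (by positivity)]
    push_cast
    have hxs : 0 ≤ x ^ s := pow_nonneg hx s
    nlinarith [mul_nonneg hxs hfac.le]
  -- chain the steps downwards from `S`
  suffices h : ∀ d s, s + d = S → x ^ s / s.factorial ≤ x ^ S / S.factorial by
    intro s hs
    exact h (S - s) s (by omega)
  intro d
  induction d with
  | zero => intro s hs; subst hs; simp
  | succ d ih =>
    intro s hs
    exact (hstep s (by omega)).trans (ih (s + 1) (by omega))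

/-- **Truncated binomial sum**: for `y ≥ 0` and `S ≤ Ny`,
`∑_{s ≤ S} C(N, s) y^s ≤ (S+1) (Ny)^S / S!`. [folklore] -/
theorem sum_choose_mul_pow_le (N S : ℕ) {y : ℝ} (hy : 0 ≤ y) (hS : (S : ℝ) ≤ N * y) :
    ∑ s ∈ Finset.range (S + 1), (N.choose s : ℝ) * y ^ s ≤
      ((S : ℝ) + 1) * (((N : ℝ) * y) ^ S / S.factorial) := by
  have hNy : 0 ≤ (N : ℝ) * y := by positivity
  calc ∑ s ∈ Finset.range (S + 1), (N.choose s : ℝ) * y ^ s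
      ≤ ∑ s ∈ Finset.range (S + 1), ((N : ℝ) * y) ^ s / s.factorial := by
        refine sum_le_sum fun s _ => ?_
        have h := Nat.choose_le_pow_div s N (α := ℝ)
        calc (N.choose s : ℝ) * y ^ s ≤ ((N : ℝ) ^ s / s.factorial) * y ^ s :=
              mul_le_mul_of_nonneg_right h (by positivity)
          _ = ((N : ℝ) * y) ^ s / s.factorial := by rw [mul_pow]; ring
    _ ≤ ∑ _s ∈ Finset.range (S + 1), ((N : ℝ) * y) ^ S / S.factorial := by
        refine sum_le_sum fun s hs => ?_
        rw [Finset.mem_range] at hs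
        exact pow_div_factorial_mono hNy hS s (by omega)
    _ = ((S : ℝ) + 1) * (((N : ℝ) * y) ^ S / S.factorial) := by
        rw [sum_const, Finset.card_range, nsmul_eq_mul]; push_cast; ring

/-- **Stirling**: `x^S / S! ≤ (e x / S)^S` for `x ≥ 0` (from `√(2πS) (S/e)^S ≤ S!`).
[folklore] -/
theorem pow_div_factorial_le_stirling {x : ℝ} (hx : 0 ≤ x) (S : ℕ) :
    x ^ S / S.factorial ≤ (exp 1 * x / S) ^ S := by
  rcases Nat.eq_zero_or_pos S with hS | hS
  · subst hS; simp
  have hst := Stirling.le_factorial_stirling S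
  have hsqrt : 1 ≤ √(2 * π * S) := by
    rw [Real.one_le_sqrt]
    have hS1 : (1 : ℝ) ≤ S := by exact_mod_cast hS
    have hπ : 2 ≤ π := Real.two_le_pi
    nlinarith
  have hSe : 0 < ((S : ℝ) / exp 1) ^ S := by positivity
  have hfac : ((S : ℝ) / exp 1) ^ S ≤ S.factorial := by
    calc ((S : ℝ) / exp 1) ^ S = 1 * ((S : ℝ) / exp 1) ^ S := (one_mul _).symm
      _ ≤ √(2 * π * S) * ((S : ℝ) / exp 1) ^ S := mul_le_mul_of_nonneg_right hsqrt hSe.le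
      _ ≤ S.factorial := hst
  have hfacpos : (0 : ℝ) < S.factorial := by exact_mod_cast Nat.factorial_pos S
  rw [div_le_iff₀ hfacpos]
  calc x ^ S = (exp 1 * x / S) ^ S * ((S : ℝ) / exp 1) ^ S := by
        rw [← mul_pow]
        congr 1
        have hS' : (S : ℝ) ≠ 0 := by exact_mod_cast hS.ne'
        field_simp
    _ ≤ (exp 1 * x / S) ^ S * S.factorial :=
        mul_le_mul_of_nonneg_left hfac (by positivity)

/-- Monotonicity of `s ↦ s (1 + log (X/s))` on `(0, X]` (from `log t ≤ t - 1`). [folklore] -/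
theorem mul_one_add_log_div_mono {s s₀ X : ℝ} (hs : 0 < s) (hss : s ≤ s₀) (hsX : s₀ ≤ X) :
    s * (1 + log (X / s)) ≤ s₀ * (1 + log (X / s₀)) := by
  have hs₀ : 0 < s₀ := lt_of_lt_of_le hs hss
  have hX : 0 < X := lt_of_lt_of_le hs₀ hsX
  rw [log_div hX.ne' hs.ne', log_div hX.ne' hs₀.ne']
  -- `s log(s₀/s) ≤ s₀ - s`
  have h1 : s * (log s₀ - log s) ≤ s₀ - s := by
    rw [← log_div hs₀.ne' hs.ne']
    have := log_le_sub_one_of_pos (div_pos hs₀ hs)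
    calc s * log (s₀ / s) ≤ s * (s₀ / s - 1) := mul_le_mul_of_nonneg_left this hs.le
      _ = s₀ - s := by field_simp
  -- `log s₀ ≤ log X`
  have h2 : log s₀ ≤ log X := log_le_log hs₀ hsX
  nlinarith [mul_le_mul_of_nonneg_left h2 (sub_nonneg.2 hss)]

/-- `log x ≤ 2 √x` for `x > 0`. [folklore] -/
theorem log_le_two_mul_sqrt {x : ℝ} (hx : 0 < x) : log x ≤ 2 * √x := by
  have h := log_le_sub_one_of_pos (Real.sqrt_pos.2 hx)
  rw [Real.log_sqrt hx.le] at h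
  have : 0 ≤ √x := Real.sqrt_nonneg x
  linarith

/-- **The exponent inequality**: for `u ≥ max (4Q/δ) (16 Q² a/δ²)` one has
`Q (2 + log (a u)) ≤ δ u` (via `log (au) ≤ 2 √(au)`). [folklore] -/
theorem mul_two_add_log_le {Q δ a u : ℝ} (hQ : 0 < Q) (hδ : 0 < δ) (ha : 0 < a)
    (hu2 : 4 * Q / δ ≤ u) (hu3 : 16 * Q ^ 2 * a / δ ^ 2 ≤ u) : Q * (2 + log (a * u)) ≤ δ * u := by
  have hu : 0 < u := lt_of_lt_of_le (by positivity) hu2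
  have hlog := log_le_two_mul_sqrt (mul_pos ha hu)
  rw [Real.sqrt_mul ha.le] at hlog
  -- `2Q ≤ δu/2`
  have h1 : 2 * Q ≤ δ * u / 2 := by
    rw [div_le_iff₀ hδ] at hu2; linarith
  -- `2Q √a √u ≤ δu/2`, i.e. `4 Q √a ≤ δ √u`
  have h2 : 2 * Q * (√a * √u) ≤ δ * u / 2 := by
    have hsa : 0 ≤ √a := Real.sqrt_nonneg a
    have hsu : 0 < √u := Real.sqrt_pos.2 hu
    have key : 4 * Q * √a ≤ δ * √u := by
      -- square both sides
      have lhs_nonneg : 0 ≤ 4 * Q * √a := by positivity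
      rw [← abs_of_nonneg lhs_nonneg, ← abs_of_nonneg (by positivity : 0 ≤ δ * √u), ← sq_le_sq]
      rw [mul_pow, mul_pow, Real.sq_sqrt ha.le, mul_pow, Real.sq_sqrt hu.le]
      rw [div_le_iff₀ (by positivity)] at hu3
      nlinarith
    have : 2 * Q * (√a * √u) = (4 * Q * √a) * √u / 2 := by ring
    rw [this, div_le_div_iff_of_pos_right (by norm_num : (0:ℝ) < 2)]
    calc 4 * Q * √a * √u ≤ δ * √u * √u := mul_le_mul_of_nonneg_right key hsu.le
      _ = δ * u := by rw [mul_assoc, Real.mul_self_sqrt hu.le]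
  calc Q * (2 + log (a * u)) ≤ Q * (2 + 2 * (√a * √u)) := by
        apply mul_le_mul_of_nonneg_left _ hQ.le; linarith
    _ = 2 * Q + 2 * Q * (√a * √u) := by ring
    _ ≤ δ * u / 2 + δ * u / 2 := add_le_add h1 h2
    _ = δ * u := by ring

/-- **The real-number bound of the union bound** (Nenadov–Steger p. 3: "By choosing `C`
sufficiently large (with respect to `k`) we may assume that
`∑_s (e 2^{rk} n² p/(2s))^s ≤ … ≤ e^{δ n² p/2}` and thus `P[G_{n,p} ↛ (F)^e_r] = o(1)`"):
with `N = C(n,2) ≥ 1`, `2N ≤ n²`, `D = n^{1/m₂}`, `u = pD`, `a = 2^Q/Q` and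
`u ≥ max(Q/2^Q, 4Q/δ, 16Q²a/δ²)`,
`(1-p)^{⌈δn²⌉} ∑_{s ≤ ⌊QN/D⌋} C(N,s) (2^Q p)^s ≤ exp(-(δ/2) u n²/D)`.
[cite: NenadovSteger2014, proof of Thm. 1 (1-statement), p. 3] -/
theorem unionBound_real_le (N Q : ℕ) (hN : 1 ≤ N) (hQ : 1 ≤ Q) {n2 D δ p : ℝ}
    (hn2 : 2 * (N : ℝ) ≤ n2) (hD : 0 < D) (hδ : 0 < δ) (hp0 : 0 < p) (hp1 : p ≤ 1)
    (hu1 : (Q : ℝ) ≤ 2 ^ Q * (p * D)) (hu2 : 4 * Q / δ ≤ p * D)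
    (hu3 : 16 * (Q : ℝ) ^ 2 * (2 ^ Q / Q) / δ ^ 2 ≤ p * D) :
    (1 - p) ^ ⌈δ * n2⌉₊ *
        ∑ s ∈ Finset.range (⌊(Q : ℝ) * (N / D)⌋₊ + 1), (N.choose s : ℝ) * ((2 : ℝ) ^ Q * p) ^ s ≤
      exp (-(δ / 2) * (p * D) * n2 / D) := by
  set u := p * D with hu
  set y : ℝ := 2 ^ Q * p with hy
  set S₀ : ℝ := (Q : ℝ) * (N / D) with hS₀
  set S : ℕ := ⌊S₀⌋₊ with hSdef
  have hQR : (1 : ℝ) ≤ Q := by exact_mod_cast hQ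
  have hNR : (1 : ℝ) ≤ N := by exact_mod_cast hN
  have hy0 : 0 < y := by positivity
  have hS₀pos : 0 < S₀ := by positivity
  have hSS₀ : (S : ℝ) ≤ S₀ := Nat.floor_le hS₀pos.le
  -- `S₀ ≤ N y`
  have hS₀Ny : S₀ ≤ N * y := by
    rw [hS₀, hy]
    rw [mul_div_assoc', div_le_iff₀ hD]
    calc (Q : ℝ) * N ≤ (2 ^ Q * (p * D)) * N := mul_le_mul_of_nonneg_right hu1 (by positivity)
      _ = N * (2 ^ Q * p) * D := by ring
  have hSNy : (S : ℝ) ≤ N * y := hSS₀.trans hS₀Ny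
  -- (1) the `(1-p)` factor
  have h1 : (1 - p) ^ ⌈δ * n2⌉₊ ≤ exp (-(p * δ * n2)) := by
    have hc : δ * n2 ≤ ⌈δ * n2⌉₊ := Nat.le_ceil _
    calc (1 - p) ^ ⌈δ * n2⌉₊ ≤ (exp (-p)) ^ ⌈δ * n2⌉₊ :=
          pow_le_pow_left₀ (by linarith) (by have := add_one_le_exp (-p); linarith) _
      _ = exp (-p * ⌈δ * n2⌉₊) := by rw [← exp_nat_mul]; ring_nf
      _ ≤ exp (-(p * δ * n2)) := by
          rw [exp_le_exp]
          have := mul_le_mul_of_nonneg_left hc hp0.le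
          nlinarith
  -- (2) the sum
  have h2 : ∑ s ∈ Finset.range (S + 1), (N.choose s : ℝ) * y ^ s ≤ exp S₀ * exp (S₀ * (1 + log (N * y / S₀))) := by
    have hsum := sum_choose_mul_pow_le N S hy0.le hSNy
    have hstir := pow_div_factorial_le_stirling (show 0 ≤ (N : ℝ) * y by positivity) S
    have hS1 : (S : ℝ) + 1 ≤ exp S₀ := by
      have := add_one_le_exp S₀; linarith
    have hmain : (exp 1 * ((N : ℝ) * y) / S) ^ S ≤ exp (S₀ * (1 + log (N * y / S₀))) := by
      rcases Nat.eq_zero_or_pos S with hS0 | hSpos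
      · rw [hS0, pow_zero]
        apply one_le_exp
        apply mul_nonneg hS₀pos.le
        have : 1 ≤ N * y / S₀ := by rw [le_div_iff₀ hS₀pos]; linarith
        have := log_nonneg this
        linarith
      · have hSposR : (0 : ℝ) < S := by exact_mod_cast hSpos
        have hinner : 0 < exp 1 * ((N : ℝ) * y) / S := by positivity
        rw [← rpow_natCast _ S, ← exp_log hinner, ← exp_mul, exp_le_exp]
        rw [log_div (by positivity) hSposR.ne', log_mul (exp_pos 1).ne' (by positivity), log_exp]
        have := mul_one_add_log_div_mono hSposR hSS₀ hS₀Ny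
        rw [log_div (by positivity) hSposR.ne'] at this
        linarith
    calc ∑ s ∈ Finset.range (S + 1), (N.choose s : ℝ) * y ^ s
        ≤ ((S : ℝ) + 1) * (((N : ℝ) * y) ^ S / S.factorial) := hsum
      _ ≤ exp S₀ * (exp 1 * ((N : ℝ) * y) / S) ^ S :=
          mul_le_mul hS1 hstir (by positivity) (by positivity)
      _ ≤ exp S₀ * exp (S₀ * (1 + log (N * y / S₀))) :=
          mul_le_mul_of_nonneg_left hmain (by positivity)
  -- (3) the exponent
  have hNyS₀ : (N : ℝ) * y / S₀ = (2 ^ Q / Q) * u := by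
    rw [hy, hS₀, hu]
    have hQ0 : (Q : ℝ) ≠ 0 := by positivity
    have hN0 : (N : ℝ) ≠ 0 := by positivity
    field_simp
  have hexp : S₀ * (2 + log (N * y / S₀)) ≤ δ * u * n2 / (2 * D) := by
    rw [hNyS₀]
    have hkey := mul_two_add_log_le (by positivity : (0 : ℝ) < Q) hδ (by positivity : (0:ℝ) < 2 ^ Q / Q)
      hu2 hu3
    calc S₀ * (2 + log (2 ^ Q / Q * u)) = (N / D) * (Q * (2 + log (2 ^ Q / Q * u))) := by
          rw [hS₀]; ring
      _ ≤ (N / D) * (δ * u) := mul_le_mul_of_nonneg_left hkey (by positivity)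
      _ ≤ (n2 / (2 * D)) * (δ * u) := by
          apply mul_le_mul_of_nonneg_right _ (by positivity)
          rw [div_le_div_iff₀ hD (by positivity)]
          nlinarith
      _ = δ * u * n2 / (2 * D) := by ring
  -- combine
  have hsum_nonneg : 0 ≤ ∑ s ∈ Finset.range (S + 1), (N.choose s : ℝ) * y ^ s :=
    sum_nonneg fun s _ => by positivity
  calc (1 - p) ^ ⌈δ * n2⌉₊ * ∑ s ∈ Finset.range (S + 1), (N.choose s : ℝ) * y ^ s
      ≤ exp (-(p * δ * n2)) * (exp S₀ * exp (S₀ * (1 + log (N * y / S₀)))) :=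
        mul_le_mul h1 h2 hsum_nonneg (by positivity)
    _ = exp (-(p * δ * n2) + S₀ * (2 + log (N * y / S₀))) := by
        rw [← exp_add, ← exp_add]; ring_nf
    _ ≤ exp (-(δ / 2) * u * n2 / D) := by
        rw [exp_le_exp]
        have hpd : p * δ * n2 = δ * u * n2 / D := by
          rw [hu]; field_simp
        rw [hpd]
        have : δ * u * n2 / (2 * D) = (δ * u * n2 / D) / 2 := by ring
        rw [this] at hexp
        have : -(δ / 2) * u * n2 / D = -(δ * u * n2 / D) + (δ * u * n2 / D) / 2 := by ring
        rw [this]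
        linarith

end Analysis

end Literature.Probability.RandomGraphs

namespace Literature.Probability.RandomGraphs

open Finset Real Filter Literature.Combinatorics.Hypergraph Literature.Combinatorics.SimpleGraph
open _root_.SimpleGraph _root_.MeasureTheory
open scoped _root_.Topology

section Core

variable {k : ℕ} {F : _root_.SimpleGraph (Fin k)} [DecidableRel F.Adj]

/-- A graph with `m₂(F) > 1` has at least two edges (some vertex set `U`, `|U| ≥ 3`, spans
`> |U| - 1 ≥ 2` edges). [folklore] -/
theorem two_le_card_edgeFinset_of_one_lt_m2Density (hm : 1 < m2Density F) :
    2 ≤ #F.edgeFinset := by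
  classical
  by_cases hV : 3 ≤ Fintype.card (Fin k)
  · obtain ⟨U, hU3, hUeq⟩ := exists_d2Density_eq_m2Density F hV
    rw [← hUeq, d2Density] at hm
    have hU3Q : (3 : ℚ) ≤ #U := by exact_mod_cast hU3
    have hpos : (0 : ℚ) < (#U : ℚ) - 2 := by linarith
    rw [lt_div_iff₀ hpos] at hm
    have h2 : (2 : ℚ) < induceEdgeCard F U := by linarith
    have h2' : 2 < induceEdgeCard F U := by exact_mod_cast h2
    calc 2 ≤ induceEdgeCard F U := h2'.le
      _ ≤ #F.edgeFinset := by
          rw [induceEdgeCard]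
          apply card_le_card
          intro e he
          rw [mem_filter] at he
          exact mem_edgeFinset.2 he.2
  · have h0 := m2Density_of_card_lt F (not_le.1 hV)
    rw [h0] at hm
    exact absurd hm (by norm_num)

/-- `n^{c} → ∞` along the naturals for `c > 0`. [folklore] -/
theorem tendsto_natCast_rpow_atTop {c : ℝ} (hc : 0 < c) :
    Tendsto (fun n : ℕ => (n : ℝ) ^ c) atTop atTop :=
  (tendsto_rpow_atTop hc).comp tendsto_natCast_atTop_atTop

/-- `K · n^{a} · 4^{-n^{c}} → 0` (a polynomial times a stretched exponential). [folklore] -/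
theorem tendsto_poly_mul_quarter_rpow {c : ℝ} (hc : 0 < c) (a K : ℝ) :
    Tendsto (fun n : ℕ => K * ((n : ℝ) ^ a * (4⁻¹ : ℝ) ^ ((n : ℝ) ^ c))) atTop (𝓝 0) := by
  have hlog : 0 < Real.log 4 := Real.log_pos (by norm_num)
  have h1 := tendsto_rpow_mul_exp_neg_mul_atTop_nhds_zero (a / c) (Real.log 4) hlog
  have h2 := h1.comp (tendsto_natCast_rpow_atTop hc)
  have h3 : Tendsto (fun n : ℕ => K * (((n : ℝ) ^ c) ^ (a / c) * exp (-Real.log 4 * (n : ℝ) ^ c)))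
      atTop (𝓝 (K * 0)) := h2.const_mul K
  rw [mul_zero] at h3
  refine h3.congr' ?_
  filter_upwards [eventually_gt_atTop 0] with n hn
  have hnR : (0 : ℝ) < n := by exact_mod_cast hn
  congr 2
  · rw [← Real.rpow_mul hnR.le, mul_div_cancel₀ _ hc.ne']
  · rw [Real.rpow_def_of_pos (by norm_num : (0 : ℝ) < 4⁻¹), Real.log_inv]

/-- `exp(-K n^{b}) → 0` for `K, b > 0`. [folklore] -/
theorem tendsto_exp_neg_mul_rpow {K b : ℝ} (hK : 0 < K) (hb : 0 < b) :
    Tendsto (fun n : ℕ => exp (-(K * (n : ℝ) ^ b))) atTop (𝓝 0) := by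
  have h1 : Tendsto (fun n : ℕ => K * (n : ℝ) ^ b) atTop atTop :=
    (tendsto_natCast_rpow_atTop hb).const_mul_atTop hK
  exact tendsto_exp_neg_atTop_nhds_zero.comp h1

/-- Algebra: `ε/(a·k!) · x / 2 = ε x /(a·2·k!)`. [folklore] -/
theorem eps_alg1 (ε x a kf : ℝ) (ha : a ≠ 0) (hkf : kf ≠ 0) :
    ε / (a * kf) * x / 2 = ε * x / (a * 2 * kf) := by
  field_simp

/-- Algebra: two halves. [folklore] -/
theorem eps_alg2 (ε x a kf : ℝ) (ha : a ≠ 0) (hkf : kf ≠ 0) :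
    ε * x / (a * 2 * kf) + ε * x / (a * 2 * kf) = ε * x / (a * kf) := by
  field_simp
  ring

/-- **The largeness conditions of `ns_theorem5` hold for all large `n`.** [folklore] -/
theorem eventually_largeness (hk : 3 ≤ k) (hm : 1 < m2Density F) {ε : ℝ} (hε : 0 < ε)
    (M : ℕ) :
    ∀ᶠ n : ℕ in atTop,
      max M (2 * k) ≤ n ∧ 2 ≤ n ∧
      1 ≤ etaC k #F.edgeFinset ε * (gammaC k ε * (n.choose 2 : ℝ)) *
        ((n : ℝ) ^ (1 / (m2Density F : ℝ))) ^ (#F.edgeFinset - 1) ∧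
      2 ^ (#F.edgeFinset - 1) * (n : ℝ) ^ (1 / (m2Density F : ℝ)) ≤
        gammaC k ε * (n.choose 2 : ℝ) ∧
      2 * ((#F.edgeFinset : ℝ) - 1) ≤ etaC k #F.edgeFinset ε ^ (3 ^ (#F.edgeFinset - 1)) *
        gammaC k ε * (n : ℝ) ^ (1 / (m2Density F : ℝ)) ∧
      etaC k #F.edgeFinset ε * (n.choose 2 : ℝ) *
        ((n : ℝ) ^ (1 / (m2Density F : ℝ))) ^ (#F.edgeFinset - 1) + 1 ≤ ε * (n.choose k : ℝ) ∧
      (#F.edgeFinset : ℝ) * ((n.choose 2 : ℝ) + 1) ^ #F.edgeFinset *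
        (4⁻¹ : ℝ) ^ ((n : ℝ) ^ (1 / (m2Density F : ℝ))) < 1 := by
  set eF := #F.edgeFinset with heF
  set m : ℝ := (m2Density F : ℝ) with hmdef
  set η := etaC k eF ε with hηdef
  set γ := gammaC k ε with hγdef
  have hm0 : 0 < m2Density F := lt_trans zero_lt_one hm
  have hm1 : (1 : ℝ) < m := by rw [hmdef]; exact_mod_cast hm
  have hmpos : 0 < m := by linarith
  have hc : (0 : ℝ) < 1 / m := by positivity
  have hc1 : 1 / m < 1 := by rw [div_lt_one hmpos]; exact hm1
  have hk1 : 1 ≤ k := by omega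
  have hkR : (0 : ℝ) < k := by exact_mod_cast hk1
  have hηpos : 0 < η := etaC_pos hk1 eF hε
  have hγpos : 0 < γ := gammaC_pos hk1 hε
  have hθpos : 0 < η ^ (3 ^ (eF - 1)) := pow_pos hηpos _
  have heF2 : 2 ≤ eF := by rw [heF]; exact two_le_card_edgeFinset_of_one_lt_m2Density hm
  have hexp_le : ((eF : ℝ) - 1) / m ≤ (k : ℝ) - 2 := by
    rw [heF, hmdef]; exact sub_one_div_m2Density_le hk hm0
  have hD : Tendsto (fun n : ℕ => (n : ℝ) ^ (1 / m)) atTop atTop := tendsto_natCast_rpow_atTop hc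
  have h2c : Tendsto (fun n : ℕ => (n : ℝ) ^ (2 - 1 / m)) atTop atTop :=
    tendsto_natCast_rpow_atTop (by linarith)
  have hkpow : Tendsto (fun n : ℕ => (n : ℝ) ^ (k : ℝ)) atTop atTop :=
    tendsto_natCast_rpow_atTop (by positivity)
  have hchoose2 : Tendsto (fun n : ℕ => (n.choose 2 : ℝ)) atTop atTop := by
    refine tendsto_atTop_mono' atTop ?_ (tendsto_natCast_atTop_atTop.comp (tendsto_sub_atTop_nat 1))
    filter_upwards [eventually_ge_atTop 2] with n hn
    simp only [Function.comp_apply]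
    rw [Nat.cast_choose_two, Nat.cast_sub (by omega)]
    have : (2 : ℝ) ≤ n := by exact_mod_cast hn
    push_cast
    nlinarith
  have L5lim := tendsto_poly_mul_quarter_rpow hc (2 * eF) (eF : ℝ)
  filter_upwards [eventually_ge_atTop (max M (2 * k)), eventually_ge_atTop 2,
    hchoose2.eventually_ge_atTop (1 / (η * γ)),
    h2c.eventually_ge_atTop (4 * 2 ^ (eF - 1) / γ),
    hD.eventually_ge_atTop (2 * ((eF : ℝ) - 1) / (η ^ (3 ^ (eF - 1)) * γ)),
    hkpow.eventually_ge_atTop (2 ^ (k + 1) * k.factorial / ε),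
    L5lim.eventually (gt_mem_nhds zero_lt_one)] with n hnM hn2 hL1 hL2 hL3 hL4 hL5
  have hnR : (2 : ℝ) ≤ n := by exact_mod_cast hn2
  have hnpos : (0 : ℝ) < n := by linarith
  have hn1 : (1 : ℝ) ≤ n := by linarith
  have hDge1 : 1 ≤ (n : ℝ) ^ (1 / m) := Real.one_le_rpow hn1 hc.le
  have hDpos : 0 < (n : ℝ) ^ (1 / m) := by linarith
  have hch2 : (n.choose 2 : ℝ) = n * (n - 1) / 2 := Nat.cast_choose_two ℝ n
  have hch2_ge : (n : ℝ) ^ 2 / 4 ≤ (n.choose 2 : ℝ) := by rw [hch2]; nlinarith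
  have hch2_le : (n.choose 2 : ℝ) ≤ (n : ℝ) ^ 2 / 2 := by rw [hch2]; nlinarith
  have hn2eq : (n : ℝ) ^ (2 : ℝ) = (n : ℝ) ^ 2 := by exact_mod_cast Real.rpow_natCast (n : ℝ) 2
  have hnkeq : (n : ℝ) ^ (k : ℝ) = (n : ℝ) ^ k := Real.rpow_natCast (n : ℝ) k
  refine ⟨hnM, hn2, ?_, ?_, ?_, ?_, ?_⟩
  · -- L1
    have h1 : 1 ≤ η * γ * (n.choose 2 : ℝ) := by
      rw [div_le_iff₀ (by positivity)] at hL1; linarith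
    calc (1 : ℝ) ≤ η * γ * (n.choose 2 : ℝ) := h1
      _ = η * (γ * (n.choose 2 : ℝ)) * 1 := by ring
      _ ≤ η * (γ * (n.choose 2 : ℝ)) * ((n : ℝ) ^ (1 / m)) ^ (eF - 1) := by
          apply mul_le_mul_of_nonneg_left _ (by positivity)
          exact one_le_pow₀ hDge1
  · -- L2: `2^{eF-1} n^c ≤ γ n²/4 ≤ γ C(n,2)`
    rw [div_le_iff₀ hγpos] at hL2
    have hsplit : (n : ℝ) ^ (2 : ℝ) = (n : ℝ) ^ (1 / m) * (n : ℝ) ^ (2 - 1 / m) := by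
      rw [← Real.rpow_add hnpos]; ring_nf
    calc 2 ^ (eF - 1) * (n : ℝ) ^ (1 / m) = (4 * 2 ^ (eF - 1)) * (n : ℝ) ^ (1 / m) / 4 := by ring
      _ ≤ ((n : ℝ) ^ (2 - 1 / m) * γ) * (n : ℝ) ^ (1 / m) / 4 := by
          apply div_le_div_of_nonneg_right _ (by norm_num)
          exact mul_le_mul_of_nonneg_right hL2 hDpos.le
      _ = γ * ((n : ℝ) ^ 2 / 4) := by rw [← hn2eq, hsplit]; ring
      _ ≤ γ * (n.choose 2 : ℝ) := mul_le_mul_of_nonneg_left hch2_ge hγpos.le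
  · -- L3
    rw [div_le_iff₀ (by positivity)] at hL3
    linarith
  · -- L4: `η C(n,2) D^{eF-1} + 1 ≤ η n^k/2 + 1 ≤ ε n^k/(2^k k!) ≤ ε C(n,k)`
    have hDpow : ((n : ℝ) ^ (1 / m)) ^ (eF - 1) ≤ (n : ℝ) ^ ((k : ℝ) - 2) := by
      rw [← Real.rpow_natCast, ← Real.rpow_mul hnpos.le]
      apply Real.rpow_le_rpow_of_exponent_le hn1
      rw [Nat.cast_sub (by omega), Nat.cast_one]
      calc 1 / m * ((eF : ℝ) - 1) = ((eF : ℝ) - 1) / m := by ring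
        _ ≤ (k : ℝ) - 2 := hexp_le
    have hnk : (n : ℝ) ^ 2 * (n : ℝ) ^ ((k : ℝ) - 2) = (n : ℝ) ^ k := by
      rw [← hn2eq, ← Real.rpow_add hnpos, ← hnkeq]; ring_nf
    have hfac : (0 : ℝ) < k.factorial := by exact_mod_cast Nat.factorial_pos k
    have hlhs : η * (n.choose 2 : ℝ) * ((n : ℝ) ^ (1 / m)) ^ (eF - 1) ≤ η * (n : ℝ) ^ k / 2 := by
      calc η * (n.choose 2 : ℝ) * ((n : ℝ) ^ (1 / m)) ^ (eF - 1)
          ≤ η * ((n : ℝ) ^ 2 / 2) * (n : ℝ) ^ ((k : ℝ) - 2) :=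
            mul_le_mul (mul_le_mul_of_nonneg_left hch2_le hηpos.le) hDpow (by positivity)
              (by positivity)
        _ = η * (n : ℝ) ^ k / 2 := by rw [← hnk]; ring
    have hrhs : ε * (n : ℝ) ^ k / (2 ^ k * k.factorial) ≤ ε * (n.choose k : ℝ) := by
      have := pow_div_le_choose (k := k) (n := n) ((le_max_right _ _).trans hnM)
      have h2 : ε * (((n : ℝ) / 2) ^ k / k.factorial) ≤ ε * (n.choose k : ℝ) :=
        mul_le_mul_of_nonneg_left this hε.le
      calc ε * (n : ℝ) ^ k / (2 ^ k * k.factorial) = ε * (((n : ℝ) / 2) ^ k / k.factorial) := by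
            rw [div_pow]; field_simp
        _ ≤ ε * (n.choose k : ℝ) := h2
    -- `η ≤ ε/(2^k k!)`
    have hηle : η ≤ ε / (2 ^ k * k.factorial) := by
      have h1 := etaC_le_div k eF ε
      rw [← hηdef] at h1
      refine h1.trans ?_
      apply div_le_div_of_nonneg_left hε.le (by positivity)
      have hkk : (1 : ℝ) ≤ (k : ℝ) ^ k := one_le_pow₀ (by exact_mod_cast hk1)
      calc (2 : ℝ) ^ k * k.factorial = 1 * (2 ^ k * k.factorial) := by ring
        _ ≤ (12 * (k : ℝ) ^ k) * (2 ^ k * k.factorial) :=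
            mul_le_mul_of_nonneg_right (by linarith) (by positivity)
        _ = 12 * (k : ℝ) ^ k * k.factorial * 2 ^ k := by ring
    -- `1 ≤ ε n^k /(2^{k+1} k!)`
    have hone : 1 ≤ ε * (n : ℝ) ^ k / (2 ^ (k + 1) * k.factorial) := by
      rw [div_le_iff₀ hε] at hL4
      rw [hnkeq] at hL4
      rw [le_div_iff₀ (by positivity)]
      linarith
    have hnkpos : (0 : ℝ) ≤ (n : ℝ) ^ k := by positivity
    have hA : η * (n : ℝ) ^ k / 2 ≤ ε * (n : ℝ) ^ k / (2 ^ (k + 1) * k.factorial) := by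
      have h1 := mul_le_mul_of_nonneg_right hηle hnkpos
      have h2 : ε / (2 ^ k * k.factorial) * (n : ℝ) ^ k / 2 =
          ε * (n : ℝ) ^ k / (2 ^ (k + 1) * k.factorial) := by
        rw [pow_succ]; exact eps_alg1 ε _ _ _ (by positivity) hfac.ne'
      linarith [h2]
    have hB : ε * (n : ℝ) ^ k / (2 ^ (k + 1) * k.factorial) +
        ε * (n : ℝ) ^ k / (2 ^ (k + 1) * k.factorial) = ε * (n : ℝ) ^ k / (2 ^ k * k.factorial) := by
      rw [pow_succ]; exact eps_alg2 _ _ _ _ (by positivity) hfac.ne'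
    linarith [hlhs, hA, hB, hone, hrhs]
  · -- L5: `(C(n,2)+1)^{eF} ≤ (n²)^{eF} = n^{2 eF}`
    have hch1 : (n.choose 2 : ℝ) + 1 ≤ (n : ℝ) ^ 2 := by rw [hch2]; nlinarith
    have e1 : (n : ℝ) ^ (2 * (eF : ℝ)) = ((n : ℝ) ^ 2) ^ eF := by
      rw [Real.rpow_mul hnpos.le, hn2eq]
      exact Real.rpow_natCast _ eF
    have hpow : ((n.choose 2 : ℝ) + 1) ^ eF ≤ ((n : ℝ) ^ 2) ^ eF :=
      pow_le_pow_left₀ (by positivity) hch1 eF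
    set W : ℝ := (4⁻¹ : ℝ) ^ ((n : ℝ) ^ (1 / m)) with hW
    have hW0 : 0 ≤ W := by rw [hW]; positivity
    have heF0 : (0 : ℝ) ≤ eF := Nat.cast_nonneg _
    rw [e1] at hL5
    have h1 : (eF : ℝ) * ((n.choose 2 : ℝ) + 1) ^ eF * W ≤ (eF : ℝ) * ((n : ℝ) ^ 2) ^ eF * W :=
      mul_le_mul_of_nonneg_right (mul_le_mul_of_nonneg_left hpow heF0) hW0
    have h2 : (eF : ℝ) * ((n : ℝ) ^ 2) ^ eF * W = (eF : ℝ) * (((n : ℝ) ^ 2) ^ eF * W) := by ring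
    linarith [h1, h2, hL5]

end Core

end Literature.Probability.RandomGraphs

namespace Literature.Probability.RandomGraphs

open Finset Real Filter Literature.Combinatorics.Hypergraph Literature.Combinatorics.SimpleGraph
open _root_.SimpleGraph _root_.MeasureTheory
open scoped _root_.Topology

section CoreThm

variable {k : ℕ} {F : _root_.SimpleGraph (Fin k)} [DecidableRel F.Adj]

/-- From an eventual bound `Pr[¬Arrows] ≤ g n` with `g → 0` to `Pr[Arrows] → 1`
(complement rule and squeezing). [folklore] -/
theorem tendsto_arrows_of_compl_le {k : ℕ} {F : _root_.SimpleGraph (Fin k)} {r : ℕ}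
    (p : ℕ → ℝ) (g : ℕ → ℝ) (hg : Tendsto g atTop (𝓝 0))
    (hle : ∀ᶠ n : ℕ in atTop, (erdosRenyi n (p n)).toOuterMeasure {G | ¬ Arrows G F r} ≤
      ENNReal.ofReal (g n)) :
    Tendsto (fun n : ℕ => (erdosRenyi n (p n)).toOuterMeasure
      {G : _root_.SimpleGraph (Fin n) | Arrows G F r}) atTop (𝓝 1) := by
  have hg' : Tendsto (fun n => ENNReal.ofReal (g n)) atTop (𝓝 0) := by
    have := ENNReal.tendsto_ofReal hg
    rwa [ENNReal.ofReal_zero] at this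
  have hlow : Tendsto (fun n => (1 : ENNReal) - ENNReal.ofReal (g n)) atTop (𝓝 1) := by
    have := ENNReal.Tendsto.sub (tendsto_const_nhds (x := (1 : ENNReal))) hg'
      (Or.inl ENNReal.one_ne_top)
    rwa [tsub_zero] at this
  have hsum : ∀ n : ℕ, (erdosRenyi n (p n)).toOuterMeasure {G | Arrows G F r} +
      (erdosRenyi n (p n)).toOuterMeasure {G | ¬ Arrows G F r} = 1 := fun n =>
    (erdosRenyi n (p n)).toOuterMeasure_add_compl {G : _root_.SimpleGraph (Fin n) | Arrows G F r}
  refine tendsto_of_tendsto_of_tendsto_of_le_of_le' hlow tendsto_const_nhds ?_ ?_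
  · filter_upwards [hle] with n hn
    have h1 := hsum n
    have hfin : (erdosRenyi n (p n)).toOuterMeasure {G | ¬ Arrows G F r} ≠ ⊤ := by
      apply ne_top_of_le_ne_top ENNReal.one_ne_top
      rw [← h1]; exact le_add_self
    have h2 : (erdosRenyi n (p n)).toOuterMeasure {G | Arrows G F r} =
        1 - (erdosRenyi n (p n)).toOuterMeasure {G | ¬ Arrows G F r} := by
      rw [← h1, ENNReal.add_sub_cancel_right hfin]
    rw [h2]
    exact tsub_le_tsub_left hn 1
  · filter_upwards with n
    rw [← hsum n]
    exact le_self_add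

/-- `2 C(n,2) ≤ n²`. [folklore] -/
theorem two_mul_choose_two_le (n : ℕ) : 2 * (n.choose 2 : ℝ) ≤ (n : ℝ) ^ 2 := by
  rw [Nat.cast_choose_two ℝ n]
  nlinarith [Nat.cast_nonneg (α := ℝ) n]

/-- **The bound at a fixed large `n`**: with the supersaturation corollary at `n` (`hcor`), the
largeness conditions, `p ≤ 1` and `C ≤ p n^{1/m₂(F)}` for a constant `C` dominating
`Q/2^Q`, `4Q/δ`, `16Q²(2^Q/Q)/δ²` (`Q = r R (e_F - 1)`), one has
`Pr[G(n,p) ↛ (F)_r] ≤ exp(-(δC/2) n^{2 - 1/m₂(F)})`.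
[cite: NenadovSteger2014, proof of Thm. 1 (1-statement), p. 3] -/
theorem not_arrows_le_exp_at (hF : ∀ a : Fin k, ∃ b, F.Adj a b) (hk : 3 ≤ k)
    (hm : 1 < m2Density F) {r : ℕ} {ε δ : ℝ} (hε : 0 < ε) (hδ : 0 < δ) {R : ℕ}
    (hR : (1 - etaC k #F.edgeFinset ε ^ (3 ^ (#F.edgeFinset - 1)) / 2) ^ R < gammaC k ε)
    {n : ℕ} (hL0 : 2 * k ≤ n) (hn2 : 2 ≤ n)
    (L1 : 1 ≤ etaC k #F.edgeFinset ε * (gammaC k ε * (n.choose 2 : ℝ)) *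
      ((n : ℝ) ^ (1 / (m2Density F : ℝ))) ^ (#F.edgeFinset - 1))
    (L2 : 2 ^ (#F.edgeFinset - 1) * (n : ℝ) ^ (1 / (m2Density F : ℝ)) ≤
      gammaC k ε * (n.choose 2 : ℝ))
    (L3 : 2 * ((#F.edgeFinset : ℝ) - 1) ≤ etaC k #F.edgeFinset ε ^ (3 ^ (#F.edgeFinset - 1)) *
      gammaC k ε * (n : ℝ) ^ (1 / (m2Density F : ℝ)))
    (L4 : etaC k #F.edgeFinset ε * (n.choose 2 : ℝ) *
      ((n : ℝ) ^ (1 / (m2Density F : ℝ))) ^ (#F.edgeFinset - 1) + 1 ≤ ε * (n.choose k : ℝ))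
    (L5 : (#F.edgeFinset : ℝ) * ((n.choose 2 : ℝ) + 1) ^ #F.edgeFinset *
      (4⁻¹ : ℝ) ^ ((n : ℝ) ^ (1 / (m2Density F : ℝ))) < 1)
    (hcor : ∀ Cs : Fin r → Finset (Sym2 (Fin n)), (∀ j, Cs j ⊆ pairsX n) →
      (∀ j, (#(induce (copyH F n) (Cs j)) : ℝ) < ε * #(copyH F n)) →
      δ * (n : ℝ) ^ 2 ≤ #(pairsX n \ Finset.univ.biUnion Cs))
    {p C : ℝ} (hp1 : p ≤ 1) (hCpos : 0 < C)
    (hQ1 : 1 ≤ r * R * (#F.edgeFinset - 1))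
    (hC1 : ((r * R * (#F.edgeFinset - 1) : ℕ) : ℝ) / 2 ^ (r * R * (#F.edgeFinset - 1)) ≤ C)
    (hC2 : 4 * ((r * R * (#F.edgeFinset - 1) : ℕ) : ℝ) / δ ≤ C)
    (hC3 : 16 * ((r * R * (#F.edgeFinset - 1) : ℕ) : ℝ) ^ 2 *
      (2 ^ (r * R * (#F.edgeFinset - 1)) / ((r * R * (#F.edgeFinset - 1) : ℕ) : ℝ)) / δ ^ 2 ≤ C)
    (hpD : C ≤ p * (n : ℝ) ^ (1 / (m2Density F : ℝ))) :
    (erdosRenyi n p).toOuterMeasure {G | ¬ Arrows G F r} ≤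
      ENNReal.ofReal (exp (-((δ / 2 * C) * (n : ℝ) ^ (2 - 1 / (m2Density F : ℝ))))) := by
  set m : ℝ := (m2Density F : ℝ) with hmdef
  set Q : ℕ := r * R * (#F.edgeFinset - 1) with hQdef
  set D : ℝ := (n : ℝ) ^ (1 / m) with hDdef
  have hm0 : 0 < m2Density F := lt_trans zero_lt_one hm
  have hmpos : (0 : ℝ) < m := by rw [hmdef]; exact_mod_cast hm0
  have hnR : (2 : ℝ) ≤ n := by exact_mod_cast hn2
  have hnpos : (0 : ℝ) < n := by linarith
  have hn1 : (1 : ℝ) ≤ n := by linarith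
  have hD1 : 1 ≤ D := Real.one_le_rpow hn1 (by positivity)
  have hDpos : 0 < D := by linarith
  have hp0 : 0 < p := by
    by_contra h
    push Not at h
    have : p * D ≤ 0 := mul_nonpos_of_nonpos_of_nonneg h hDpos.le
    linarith
  -- containers at this `n`
  obtain ⟨Print, Cont, hPC⟩ := ns_theorem5 hF hk hm hε R hR hL0 L1 L2 L3 L4 L5
  have hprob := not_arrows_prob_le (r := r) Print Cont hPC hcor hp0.le hp1
  refine hprob.trans (ENNReal.ofReal_le_ofReal ?_)
  -- the real bound
  have hN1 : 1 ≤ n.choose 2 :=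
    calc 1 = Nat.choose 2 2 := rfl
      _ ≤ n.choose 2 := Nat.choose_le_choose 2 hn2
  have hn2' : 2 * (n.choose 2 : ℝ) ≤ (n : ℝ) ^ 2 := two_mul_choose_two_le n
  have hu1 : (Q : ℝ) ≤ 2 ^ Q * (p * D) := by
    rw [div_le_iff₀ (by positivity)] at hC1
    calc (Q : ℝ) ≤ C * 2 ^ Q := hC1
      _ ≤ (p * D) * 2 ^ Q := mul_le_mul_of_nonneg_right hpD (by positivity)
      _ = 2 ^ Q * (p * D) := mul_comm _ _
  have hu2 : 4 * Q / δ ≤ p * D := hC2.trans hpD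
  have hu3 : 16 * (Q : ℝ) ^ 2 * (2 ^ Q / Q) / δ ^ 2 ≤ p * D := hC3.trans hpD
  have hmain := unionBound_real_le (n.choose 2) Q hN1 hQ1 (n2 := (n : ℝ) ^ 2) (D := D)
    hn2' hDpos hδ hp0 hp1 hu1 hu2 hu3
  have hQcast : ((r * R * (#F.edgeFinset - 1) : ℕ) : ℝ) = (r : ℝ) * R * ((#F.edgeFinset - 1 : ℕ) : ℝ) := by
    push_cast; ring
  rw [hQcast] at hmain
  refine hmain.trans ?_
  rw [exp_le_exp]
  have hsplit : (n : ℝ) ^ (2 - 1 / m) = (n : ℝ) ^ 2 / D := by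
    rw [hDdef, Real.rpow_sub hnpos, Real.rpow_two]
  rw [hsplit]
  have h1 : -(δ / 2) * (p * D) * (n : ℝ) ^ 2 / D = -((δ / 2) * (p * D) * ((n : ℝ) ^ 2 / D)) := by
    ring
  rw [h1, neg_le_neg_iff]
  have hn2pos : 0 ≤ (n : ℝ) ^ 2 / D := by positivity
  calc δ / 2 * C * ((n : ℝ) ^ 2 / D) ≤ δ / 2 * (p * D) * ((n : ℝ) ^ 2 / D) := by
        apply mul_le_mul_of_nonneg_right _ hn2pos
        exact mul_le_mul_of_nonneg_left hpD (by positivity)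
    _ = _ := rfl

/-- **The 1-statement for graphs without isolated vertices** (Rödl–Ruciński Thm. 1′ /
Nenadov–Steger Thm. 1, 1-statement; core case): `F` on `Fin k`, `k ≥ 3`, no isolated vertices,
`m₂(F) > 1`, `r ≥ 1` colours: there is `C > 0` such that `Pr[G(n, p_n) → (F)_r] → 1` whenever
`C n^{-1/m₂(F)} ≤ p_n ≤ 1` for all large `n`. Assembled from `ns_corollary3` (supersaturation),
`ns_theorem5` (containers), `not_arrows_prob_le` (union bound) and `unionBound_real_le`
(asymptotics). [cite: NenadovSteger2014, Thm. 1 (1-statement) and its proof, pp. 2–3] -/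
theorem oneStatement_core (hF : ∀ a : Fin k, ∃ b, F.Adj a b) (hk : 3 ≤ k)
    (hm : 1 < m2Density F) (r : ℕ) (hr : 1 ≤ r) :
    ∃ C : ℝ, 0 < C ∧ ∀ p : ℕ → ℝ,
      (∀ᶠ n : ℕ in atTop, C * (n : ℝ) ^ (-(1 / (m2Density F : ℝ))) ≤ p n) →
      (∀ᶠ n : ℕ in atTop, p n ≤ 1) →
        Tendsto (fun n : ℕ => (erdosRenyi n (p n)).toOuterMeasure
          {G : _root_.SimpleGraph (Fin n) | Arrows G F r}) atTop (𝓝 1) := by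
  classical
  have hk1 : 1 ≤ k := by omega
  have hkR : (0 : ℝ) < k := by exact_mod_cast hk1
  have hE : F.edgeFinset.Nonempty := edgeFinset_nonempty_of_noIsolated hF hk1
  have heF2 : 2 ≤ #F.edgeFinset := two_le_card_edgeFinset_of_one_lt_m2Density hm
  have hm0 : 0 < m2Density F := lt_trans zero_lt_one hm
  have hm1 : (1 : ℝ) < (m2Density F : ℝ) := by exact_mod_cast hm
  have hmpos : (0 : ℝ) < (m2Density F : ℝ) := by linarith
  -- supersaturation constants
  obtain ⟨M, hkM, hcor⟩ := ns_corollary3 hF hE r hr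
  set ε : ℝ := 1 / (2 ^ (k + 2) * k.factorial * M.choose k * r) with hεdef
  set δ : ℝ := 1 / (2 ^ (k + 2) * k.factorial * M.choose k * (k : ℝ) ^ k) with hδdef
  have hMk : (1 : ℝ) ≤ M.choose k := by exact_mod_cast Nat.choose_pos hkM
  have hrR : (1 : ℝ) ≤ r := by exact_mod_cast hr
  have hfac : (1 : ℝ) ≤ k.factorial := by exact_mod_cast Nat.factorial_pos k
  have hε : 0 < ε := by rw [hεdef]; positivity
  have hδ : 0 < δ := by rw [hδdef]; positivity
  -- container constants
  have hηpos : 0 < etaC k #F.edgeFinset ε := etaC_pos hk1 _ hε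
  have hγpos : 0 < gammaC k ε := gammaC_pos hk1 hε
  have hη1 : etaC k #F.edgeFinset ε ≤ 1 :=
    (etaC_le_pow k _ ε).trans (pow_le_one₀ (by norm_num) (by norm_num))
  have hγ1 : gammaC k ε < 1 := by
    rw [gammaC, div_lt_one (by positivity)]
    have hkk : (1 : ℝ) ≤ (k : ℝ) ^ k := one_le_pow₀ (by exact_mod_cast hk1)
    have hε1 : ε ≤ 1 := by
      rw [hεdef, div_le_one (by positivity)]
      have h4 : (1 : ℝ) ≤ 2 ^ (k + 2) := one_le_pow₀ (by norm_num)
      calc (1 : ℝ) = 1 * 1 * 1 * 1 := by ring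
        _ ≤ 2 ^ (k + 2) * k.factorial * M.choose k * r :=
            mul_le_mul (mul_le_mul (mul_le_mul h4 hfac zero_le_one (by positivity)) hMk
              zero_le_one (by positivity)) hrR zero_le_one (by positivity)
    have h8 : (8 : ℝ) ≤ 2 ^ k :=
      calc (8 : ℝ) = 2 ^ 3 := by norm_num
        _ ≤ 2 ^ k := pow_le_pow_right₀ (by norm_num) hk
    have hprod : (1 : ℝ) < 2 ^ k * k.factorial * (k : ℝ) ^ k :=
      calc (1 : ℝ) < 8 := by norm_num
        _ ≤ 2 ^ k := h8
        _ = 2 ^ k * 1 * 1 := by ring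
        _ ≤ 2 ^ k * k.factorial * (k : ℝ) ^ k :=
            mul_le_mul (mul_le_mul_of_nonneg_left hfac (by positivity)) hkk zero_le_one
              (by positivity)
    exact lt_of_le_of_lt hε1 hprod
  have hθpos : 0 < etaC k #F.edgeFinset ε ^ (3 ^ (#F.edgeFinset - 1)) := pow_pos hηpos _
  have hθ1 : etaC k #F.edgeFinset ε ^ (3 ^ (#F.edgeFinset - 1)) ≤ 1 := pow_le_one₀ hηpos.le hη1
  obtain ⟨R, hR⟩ := exists_pow_lt_of_lt_one hγpos
    (show 1 - etaC k #F.edgeFinset ε ^ (3 ^ (#F.edgeFinset - 1)) / 2 < 1 by linarith)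
  have hR1 : 1 ≤ R := by
    rcases Nat.eq_zero_or_pos R with h0 | h0
    · rw [h0, pow_zero] at hR; linarith
    · exact h0
  set Q : ℕ := r * R * (#F.edgeFinset - 1) with hQdef
  have hQ1 : 1 ≤ Q := Nat.mul_pos (Nat.mul_pos hr hR1) (by omega)
  -- the constant
  set C : ℝ := max ((Q : ℝ) / 2 ^ Q) (max (4 * Q / δ) (16 * (Q : ℝ) ^ 2 * (2 ^ Q / Q) / δ ^ 2))
    with hCdef
  have hCpos : 0 < C := lt_of_lt_of_le (by positivity) (le_max_left _ _)
  refine ⟨C, hCpos, fun p hpC hp1 => ?_⟩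
  have hev := eventually_largeness hk hm hε M
  have hc1 : 1 / (m2Density F : ℝ) < 1 := by rw [div_lt_one hmpos]; exact hm1
  apply tendsto_arrows_of_compl_le p
    (fun n : ℕ => exp (-((δ / 2 * C) * (n : ℝ) ^ (2 - 1 / (m2Density F : ℝ)))))
    (tendsto_exp_neg_mul_rpow (by positivity) (by linarith))
  filter_upwards [hev, hpC, hp1] with n hL hpn hp1n
  obtain ⟨hnM, hn2, L1, L2, L3, L4, L5⟩ := hL
  have hnR : (2 : ℝ) ≤ n := by exact_mod_cast hn2
  have hnpos : (0 : ℝ) < n := by linarith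
  have hpD : C ≤ p n * (n : ℝ) ^ (1 / (m2Density F : ℝ)) := by
    have hDpos : 0 < (n : ℝ) ^ (1 / (m2Density F : ℝ)) := Real.rpow_pos_of_pos hnpos _
    have : C * (n : ℝ) ^ (-(1 / (m2Density F : ℝ))) = C / (n : ℝ) ^ (1 / (m2Density F : ℝ)) := by
      rw [Real.rpow_neg hnpos.le]; ring
    rw [this, div_le_iff₀ hDpos] at hpn
    exact hpn
  exact not_arrows_le_exp_at hF hk hm hε hδ hR ((le_max_right _ _).trans hnM) hn2 L1 L2 L3 L4 L5
    (hcor n hnM) hp1n hCpos hQ1 (le_max_left _ _)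
    ((le_max_left _ _).trans (le_max_right _ _)) ((le_max_right _ _).trans (le_max_right _ _)) hpD

end CoreThm

end Literature.Probability.RandomGraphs

namespace Literature.Probability.RandomGraphs

open Finset Real Filter Literature.Combinatorics.Hypergraph Literature.Combinatorics.SimpleGraph
open _root_.SimpleGraph _root_.MeasureTheory
open scoped _root_.Topology

/-! ## Removing isolated vertices, clamping `p`, and the discharge -/

section Reduce

variable {k : ℕ} (F : _root_.SimpleGraph (Fin k)) [DecidableRel F.Adj]

/-- The non-isolated vertices of `F`. [folklore] -/
def vplus : Finset (Fin k) := univ.filter fun v => ∃ w, F.Adj v w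

/-- The increasing enumeration of the non-isolated vertices. [folklore] -/
noncomputable def vemb : Fin #(vplus F) ↪ Fin k := ((vplus F).orderEmbOfFin rfl).toEmbedding

/-- `F` with its isolated vertices removed, as a graph on `Fin k⁺` (an `abbrev`, so that the
decidability of adjacency is inherited from `SimpleGraph.comap`). [folklore] -/
noncomputable abbrev fplus : _root_.SimpleGraph (Fin #(vplus F)) := F.comap (vemb F)

variable {F}

/-- Membership in `vplus`. [folklore] -/
theorem mem_vplus {v : Fin k} : v ∈ vplus F ↔ ∃ w, F.Adj v w := by simp [vplus]

/-- The range of `vemb` is `vplus`. [folklore] -/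
theorem exists_vemb_eq_iff {v : Fin k} : (∃ a, vemb F a = v) ↔ v ∈ vplus F := by
  constructor
  · rintro ⟨a, rfl⟩
    exact (vplus F).orderEmbOfFin_mem rfl a
  · intro hv
    have : v ∈ Set.range ((vplus F).orderEmbOfFin rfl) := by
      rw [range_orderEmbOfFin]; exact hv
    obtain ⟨a, ha⟩ := this
    exact ⟨a, ha⟩

/-- Adjacency in `fplus`. [folklore] -/
theorem fplus_adj {a b : Fin #(vplus F)} : (fplus F).Adj a b ↔ F.Adj (vemb F a) (vemb F b) :=
  Iff.rfl

/-- `fplus F` has no isolated vertices. [folklore] -/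
theorem fplus_noIsolated (a : Fin #(vplus F)) : ∃ b, (fplus F).Adj a b := by
  have ha : vemb F a ∈ vplus F := exists_vemb_eq_iff.1 ⟨a, rfl⟩
  obtain ⟨w, hw⟩ := mem_vplus.1 ha
  have hwp : w ∈ vplus F := mem_vplus.2 ⟨_, hw.symm⟩
  obtain ⟨b, hb⟩ := exists_vemb_eq_iff.2 hwp
  exact ⟨b, by rw [fplus_adj, hb]; exact hw⟩

/-- Induced edge counts are preserved by `vemb`: `e(F⁺[U⁺]) = e(F[vemb(U⁺)])`. [folklore] -/
theorem induceEdgeCard_fplus (U : Finset (Fin #(vplus F))) :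
    induceEdgeCard (fplus F) U = induceEdgeCard F (U.map (vemb F)) := by
  classical
  rw [induceEdgeCard, induceEdgeCard, Finset.sym2_map, filter_map, card_map]
  congr 1
  ext e
  simp only [mem_filter, Function.comp_apply, and_congr_right_iff]
  intro _
  induction e using Sym2.ind with
  | _ a b =>
    rw [Function.Embedding.sym2Map_apply, Sym2.map_mk, mem_edgeSet, mem_edgeSet, fplus_adj]

/-- `m₂(F⁺) ≤ m₂(F)`. [folklore] -/
theorem m2Density_fplus_le (hm : 0 ≤ m2Density F) : m2Density (fplus F) ≤ m2Density F := by
  classical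
  by_cases hV : 3 ≤ Fintype.card (Fin #(vplus F))
  · rw [m2Density_le_iff _ hV]
    intro U hU
    have hcard : #(U.map (vemb F)) = #U := card_map _
    have hd : d2Density (fplus F) U = d2Density F (U.map (vemb F)) := by
      rw [d2Density, d2Density, induceEdgeCard_fplus, hcard]
    rw [hd]
    exact d2Density_le_m2Density F (by rw [hcard]; exact hU)
  · rw [m2Density_of_card_lt _ (not_le.1 hV)]
    exact hm

/-- Edges inside `U` are edges inside `U ∩ V⁺`. [folklore] -/
theorem induceEdgeCard_filter_vplus (U : Finset (Fin k)) :
    induceEdgeCard F (U.filter fun v => v ∈ vplus F) = induceEdgeCard F U := by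
  classical
  rw [induceEdgeCard, induceEdgeCard]
  congr 1
  ext e
  simp only [mem_filter]
  constructor
  · rintro ⟨he, hE⟩
    exact ⟨Finset.sym2_mono (filter_subset _ _) he, hE⟩
  · rintro ⟨he, hE⟩
    refine ⟨?_, hE⟩
    induction e using Sym2.ind with
    | _ a b =>
      rw [mk_mem_sym2_iff] at he ⊢
      rw [mem_edgeSet] at hE
      exact ⟨mem_filter.2 ⟨he.1, mem_vplus.2 ⟨b, hE⟩⟩, mem_filter.2 ⟨he.2, mem_vplus.2 ⟨a, hE.symm⟩⟩⟩

/-- **`m₂(F⁺) > 1` and `k⁺ ≥ 3`** when `m₂(F) > 1`: a densest vertex set `U` of `F` spans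
`e ≥ 3` edges, all inside `U ∩ V⁺`, which therefore has at least `3` vertices and density
`(e-1)/(|U ∩ V⁺| - 2) ≥ (e-1)/(|U|-2) > 1`. [folklore] -/
theorem one_lt_m2Density_fplus (hm : 1 < m2Density F) :
    1 < m2Density (fplus F) ∧ 3 ≤ #(vplus F) := by
  classical
  have hV : 3 ≤ Fintype.card (Fin k) := by
    by_contra h
    rw [m2Density_of_card_lt F (not_le.1 h)] at hm
    exact absurd hm (by norm_num)
  obtain ⟨U, hU3, hUeq⟩ := exists_d2Density_eq_m2Density F hV
  have hd : 1 < d2Density F U := by rw [hUeq]; exact hm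
  set U' := U.filter fun v => v ∈ vplus F with hU'
  have he : induceEdgeCard F U' = induceEdgeCard F U := induceEdgeCard_filter_vplus U
  -- `e ≥ 3`
  have hU3Q : (3 : ℚ) ≤ #U := by exact_mod_cast hU3
  have hpos : (0 : ℚ) < (#U : ℚ) - 2 := by linarith
  have hd' := hd
  rw [d2Density, lt_div_iff₀ hpos] at hd'
  have he3Q : (2 : ℚ) < induceEdgeCard F U := by linarith
  have he3 : 3 ≤ induceEdgeCard F U := by exact_mod_cast he3Q
  -- `|U'| ≥ 3`
  have hU'3 : 3 ≤ #U' := by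
    by_contra h
    push Not at h
    have h1 : induceEdgeCard F U' ≤ (#U').choose 2 :=
      calc induceEdgeCard F U' ≤ induceEdgeCard (⊤ : _root_.SimpleGraph (Fin k)) U' :=
            induceEdgeCard_mono le_top U'
        _ = (#U').choose 2 := induceEdgeCard_top U'
    have h2 : (#U').choose 2 ≤ 1 :=
      calc (#U').choose 2 ≤ (2 : ℕ).choose 2 := Nat.choose_le_choose 2 (by omega)
        _ = 1 := rfl
    omega
  have hU'U : #U' ≤ #U := card_le_card (filter_subset _ _)
  -- pull `U'` back along `vemb`
  set Up : Finset (Fin #(vplus F)) := univ.filter fun a => vemb F a ∈ U' with hUp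
  have hmap : Up.map (vemb F) = U' := by
    ext v
    rw [Finset.mem_map]
    constructor
    · rintro ⟨a, ha, rfl⟩
      exact (mem_filter.1 ha).2
    · intro hv
      have hvp : v ∈ vplus F := (mem_filter.1 hv).2
      obtain ⟨a, rfl⟩ := exists_vemb_eq_iff.2 hvp
      exact ⟨a, mem_filter.2 ⟨mem_univ _, hv⟩, rfl⟩
  have hUpcard : #Up = #U' := by rw [← hmap, card_map]
  have hdp : d2Density (fplus F) Up = d2Density F U' := by
    rw [d2Density, d2Density, induceEdgeCard_fplus, hmap, hUpcard]
  -- `d₂(F, U') ≥ d₂(F, U) > 1`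
  have hU'3Q : (3 : ℚ) ≤ #U' := by exact_mod_cast hU'3
  have hU'UQ : (#U' : ℚ) ≤ #U := by exact_mod_cast hU'U
  have hd'' : 1 < d2Density F U' := by
    rw [d2Density, he]
    rw [d2Density] at hd
    have hpos' : (0 : ℚ) < (#U' : ℚ) - 2 := by linarith
    rw [lt_div_iff₀ hpos']
    rw [lt_div_iff₀ hpos] at hd
    linarith
  constructor
  · calc (1 : ℚ) < d2Density F U' := hd''
      _ = d2Density (fplus F) Up := hdp.symm
      _ ≤ m2Density (fplus F) := d2Density_le_m2Density _ (by rw [hUpcard]; exact hU'3)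
  · calc 3 ≤ #Up := by rw [hUpcard]; exact hU'3
      _ ≤ #(vplus F) := by
          calc #Up ≤ #(univ : Finset (Fin #(vplus F))) := card_le_card (subset_univ _)
            _ = #(vplus F) := by rw [card_univ, Fintype.card_fin]

/-- **Extending an embedding**: an embedding `f` of `Fin k⁺` into `Fin n` extends along an
embedding `e : Fin k⁺ ↪ Fin k` to an embedding of `Fin k`, provided `k ≤ n`. [folklore] -/
theorem exists_extend_embedding {kp n : ℕ} (e : Fin kp ↪ Fin k) (f : Fin kp ↪ Fin n)
    (hkn : k ≤ n) : ∃ φ : Fin k ↪ Fin n, ∀ a, φ (e a) = f a := by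
  classical
  -- complements of the ranges
  let A := {v : Fin k // ¬ ∃ a, e a = v}
  let B := {w : Fin n // ¬ ∃ a, f a = w}
  have hA : Fintype.card A = k - kp := by
    rw [Fintype.card_subtype_compl, Fintype.card_fin]
    congr 1
    rw [Fintype.card_subtype]
    have : (univ.filter fun v : Fin k => ∃ a, e a = v) = univ.map e := by
      ext v; simp [Finset.mem_map, eq_comm]
    rw [this, card_map, card_univ, Fintype.card_fin]
  have hB : Fintype.card B = n - kp := by
    rw [Fintype.card_subtype_compl, Fintype.card_fin]
    congr 1
    rw [Fintype.card_subtype]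
    have : (univ.filter fun w : Fin n => ∃ a, f a = w) = univ.map f := by
      ext w; simp [Finset.mem_map, eq_comm]
    rw [this, card_map, card_univ, Fintype.card_fin]
  have hkp : kp ≤ k := by
    have := Fintype.card_le_of_embedding e
    simpa using this
  obtain ⟨g⟩ : Nonempty (A ↪ B) := Function.Embedding.nonempty_of_card_le (by rw [hA, hB]; omega)
  -- the extension
  let φ : Fin k → Fin n := fun v =>
    if h : ∃ a, e a = v then f (Classical.choose h) else (g ⟨v, h⟩).1
  have hφe : ∀ a, φ (e a) = f a := by
    intro a
    have h : ∃ a', e a' = e a := ⟨a, rfl⟩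
    show (if h : ∃ a', e a' = e a then f (Classical.choose h) else (g ⟨e a, h⟩).1) = f a
    rw [dif_pos h]
    congr 1
    exact e.injective (Classical.choose_spec h)
  have hinj : Function.Injective φ := by
    intro v w hvw
    by_cases hv : ∃ a, e a = v <;> by_cases hw : ∃ a, e a = w
    · obtain ⟨a, rfl⟩ := hv
      obtain ⟨b, rfl⟩ := hw
      rw [hφe, hφe] at hvw
      rw [f.injective hvw]
    · exfalso
      obtain ⟨a, rfl⟩ := hv
      rw [hφe] at hvw
      have hφw : φ w = (g ⟨w, hw⟩).1 := dif_neg hw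
      rw [hφw] at hvw
      exact (g ⟨w, hw⟩).2 ⟨a, hvw⟩
    · exfalso
      obtain ⟨b, rfl⟩ := hw
      rw [hφe] at hvw
      have hφv : φ v = (g ⟨v, hv⟩).1 := dif_neg hv
      rw [hφv] at hvw
      exact (g ⟨v, hv⟩).2 ⟨b, hvw.symm⟩
    · have hφv : φ v = (g ⟨v, hv⟩).1 := dif_neg hv
      have hφw : φ w = (g ⟨w, hw⟩).1 := dif_neg hw
      rw [hφv, hφw] at hvw
      have := g.injective (Subtype.ext hvw)
      exact congrArg Subtype.val this
  exact ⟨⟨φ, hinj⟩, hφe⟩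

/-- **Arrowing `F⁺` implies arrowing `F`** on `≥ k` vertices: a monochromatic copy of `F⁺`
extends to a copy of `F` by sending the isolated vertices anywhere injectively.
[folklore] -/
theorem arrows_of_arrows_fplus {n r : ℕ} (hkn : k ≤ n) {G : _root_.SimpleGraph (Fin n)}
    (h : Arrows G (fplus F) r) : Arrows G F r := by
  intro Cl
  obtain ⟨i, ⟨cp⟩⟩ := h Cl
  refine ⟨i, ?_⟩
  obtain ⟨φ, hφ⟩ := exists_extend_embedding (vemb F) ⟨cp.toHom, cp.injective⟩ hkn
  refine ⟨⟨⟨φ, fun {v w} hvw => ?_⟩, φ.injective⟩⟩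
  have hv : v ∈ vplus F := mem_vplus.2 ⟨w, hvw⟩
  have hw : w ∈ vplus F := mem_vplus.2 ⟨v, hvw.symm⟩
  obtain ⟨a, rfl⟩ := exists_vemb_eq_iff.2 hv
  obtain ⟨b, rfl⟩ := exists_vemb_eq_iff.2 hw
  rw [hφ a, hφ b]
  exact cp.toHom.map_adj (fplus_adj.2 hvw)

end Reduce

section Clamp

/-- `bernoulliVec` depends only on the value of the parameter. [folklore] -/
theorem bernoulliVec_congr {m : ℕ} {q₁ q₂ : ENNReal} (h : q₁ = q₂) (h₁ : q₁ ≤ 1) (h₂ : q₂ ≤ 1) :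
    PlantedClique.bernoulliVec m q₁ h₁ = PlantedClique.bernoulliVec m q₂ h₂ := by
  subst h; rfl

/-- **Clamping**: `G(n, p) = G(n, min p 1)` (values `p > 1` mean the complete graph anyway).
[folklore] -/
theorem erdosRenyi_min_one (n : ℕ) (p : ℝ) : erdosRenyi n (min p 1) = erdosRenyi n p := by
  unfold erdosRenyi
  have hq : min 1 (ENNReal.ofReal (min p 1)) = min 1 (ENNReal.ofReal p) := by
    rw [(ENNReal.ofReal_mono.map_min (a := p) (b := 1)), ENNReal.ofReal_one]
    rw [← min_assoc, min_comm (1 : ENNReal) (ENNReal.ofReal p), min_assoc, min_self, min_comm]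
  rw [bernoulliVec_congr hq]

end Clamp

section Discharge

/-- `n^{-1/m⁺} ≤ n^{-1/m}` for `0 < m⁺ ≤ m`, `n ≥ 1`. [folklore] -/
theorem rpow_neg_inv_anti {x m mp : ℝ} (hx : 1 ≤ x) (hmp : 0 < mp) (hle : mp ≤ m) :
    x ^ (-(1 / mp)) ≤ x ^ (-(1 / m)) := by
  apply Real.rpow_le_rpow_of_exponent_le hx
  have hm : 0 < m := lt_of_lt_of_le hmp hle
  rw [neg_le_neg_iff, one_div_le_one_div hm hmp]
  exact hle

/-- **Rödl–Ruciński 1995, Theorem 1′ (1-statement) — DISCHARGED.** For every graph `F` on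
`Fin k` with `m₂(F) > 1` and every `r ≥ 2` there is `C > 0` such that
`Pr[G(n, p(n)) → (F)_r] → 1` for every sequence `p` with `C n^{-1/m₂(F)} ≤ p(n)` for all large `n`.
Proof: Nenadov–Steger's container proof (CPC 2016, §2) formalised in this directory and in
`Literature/Combinatorics/{Hypergraph,SimpleGraph}/`: remove the isolated vertices of `F`
(`fplus`, `m₂(F⁺) ≤ m₂(F)`, `m₂(F⁺) > 1`, and `G → (F⁺)_r ⟹ G → (F)_r` on `≥ k` vertices),
clamp `p` to `[0, 1]` (`erdosRenyi_min_one`), and apply `oneStatement_core`.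
[cite: RodlRucinski1995, Thm. 1′ (p. 919), 1-statement; NenadovSteger2014, Thm. 1 and §2] -/
theorem RodlRucinski1995_oneStatement_holds : RodlRucinski1995_oneStatement := by
  intro k F _ hm r hr
  classical
  -- the reduced graph
  obtain ⟨hmp, hkp⟩ := one_lt_m2Density_fplus (F := F) hm
  have hm0 : 0 < m2Density F := lt_trans zero_lt_one hm
  have hmle : m2Density (fplus F) ≤ m2Density F := m2Density_fplus_le hm0.le
  have hmp0 : 0 < m2Density (fplus F) := lt_trans zero_lt_one hmp
  obtain ⟨C, hC, hcore⟩ := oneStatement_core (F := fplus F) fplus_noIsolated hkp hmp r (by omega)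
  refine ⟨C, hC, fun p hp => ?_⟩
  -- clamp
  set p' : ℕ → ℝ := fun n => min (p n) 1 with hp'
  have hlim : Tendsto (fun n : ℕ => (n : ℝ) ^ (-(1 / (m2Density (fplus F) : ℝ)))) atTop (𝓝 0) :=
    (tendsto_rpow_neg_atTop (by positivity)).comp tendsto_natCast_atTop_atTop
  have hsmall : ∀ᶠ n : ℕ in atTop, C * (n : ℝ) ^ (-(1 / (m2Density (fplus F) : ℝ))) ≤ 1 := by
    have h := (hlim.const_mul C)
    rw [mul_zero] at h
    exact h.eventually (ge_mem_nhds zero_lt_one)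
  have hp'1 : ∀ᶠ n : ℕ in atTop, C * (n : ℝ) ^ (-(1 / (m2Density (fplus F) : ℝ))) ≤ p' n := by
    filter_upwards [hp, hsmall, eventually_ge_atTop 1] with n hpn hsn hn1
    have hn1R : (1 : ℝ) ≤ n := by exact_mod_cast hn1
    have hmono : C * (n : ℝ) ^ (-(1 / (m2Density (fplus F) : ℝ))) ≤
        C * (n : ℝ) ^ (-(1 / (m2Density F : ℝ))) :=
      mul_le_mul_of_nonneg_left (rpow_neg_inv_anti hn1R (by exact_mod_cast hmp0)
        (by exact_mod_cast hmle)) hC.le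
    exact le_min (hmono.trans hpn) hsn
  have hp'2 : ∀ᶠ n : ℕ in atTop, p' n ≤ 1 := Eventually.of_forall fun n => min_le_right _ _
  have hT := hcore p' hp'1 hp'2
  -- compare the events
  refine tendsto_of_tendsto_of_tendsto_of_le_of_le' hT tendsto_const_nhds ?_ ?_
  · filter_upwards [eventually_ge_atTop k] with n hkn
    rw [show erdosRenyi n (p n) = erdosRenyi n (p' n) from (erdosRenyi_min_one n (p n)).symm]
    exact measure_mono fun G hG => arrows_of_arrows_fplus hkn hG
  · filter_upwards with n
    calc (erdosRenyi n (p n)).toOuterMeasure {G | Arrows G F r}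
        ≤ (erdosRenyi n (p n)).toOuterMeasure {G | Arrows G F r} +
          (erdosRenyi n (p n)).toOuterMeasure {G | Arrows G F r}ᶜ := le_self_add
      _ = 1 := (erdosRenyi n (p n)).toOuterMeasure_add_compl _

end Discharge

end Literature.Probability.RandomGraphs
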